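/-
Copyright (c) 2026. All rights reserved.
Released under Apache 2.0 license as described in the file LICENSE.
-/
import Literature.Geometry.Kaehler.ComplexTorusQuaternionXSixSpecialPointsBurnside
import Literature.Geometry.Kaehler.ComplexTorusQuaternionXSixAtkinLehnerQuotientsSpecialPoints
import HarnessLib

/-!
# The counts of `Z(t)` on `X₆`, `X₆^{(2)}`, `X₆^{(3)}`, `X₆^{(6)}` and `X₆⁺` in closed form, for EVERY `t > 0`:
# `#(Pt(t)/Γ₆) = |L(t)/O₆^×| ∈ {4N, 4N − 2}`, `|L(t)/Γ₆| ∈ {8N, 8N − 4}`, `#(Pt(t)/Γ₆^{(d)}) ∈ {2N, 2N − 1}`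
# (`N = #(Pt(t)/Γ₆⁺) = |L(t)/N(O₆)|`), the smaller value exactly when `t ∈ ℤ² ∪ 3ℤ² ∪ 6ℤ²` — congruences and parities

[tag: complex_torus] [tag: abelian_surface] [tag: quaternion_multiplication] [tag: complex_multiplication]
[tag: shimura_curve] [tag: special_cycles] [tag: atkin_lehner] [tag: elliptic_points]

Lane `lit-hodgefound`, seat p12, row g37-#1 — THEOREMS ONLY (no definition, no named fact, no instance); the synthesis of
g36-#1 `…XSixPlusSpecialPointsCount` (`#(Pt(t)/Γ₆⁺) = |L(t)/N(O₆)|`), g36-#2 `…XSixSpecialPointsBurnside` (Burnside for the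
Klein four-group `W` on `Pt(t)/Γ₆`: `#(Pt(t)/Γ₆) + Σ_{t₀ = 1, 3, 6} #((Pt(t) ∩ Pt(t₀))/Γ₆) = 4·#(Pt(t)/Γ₆⁺)`, the correction
terms `2` or `0`, and the four case-by-case closed forms) and g36-#3 `…XSixAtkinLehnerQuotientsSpecialPoints`
(`#(Pt(t)/Γ₆) + #((Pt(t) ∩ Pt(t_d))/Γ₆) = 2·#(Pt(t)/Γ₆^{(d)})`, `t₂ = 1, t₃ = 3, t₆ = 6`), with g35's
`card_specialPoints_eq_card_unit_classes` (`#(Pt(t)/Γ₆) = |L(t)/O₆^×|`) and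
`card_normOne_classes_eq_two_mul_card_unit_classes` (`|L(t)/Γ₆| = 2·|L(t)/O₆^×|`).

Setting as in all `…XSix…` files: `B = (−1,3)_ℚ` (`D(B) = 6`), `𝔬 = ℤ⟨1, i, j, ij⟩`, the maximal order `O₆` as the
predicate `a ∈ 𝔬 ∨ a − e ∈ 𝔬` (`e = (1 + i + j − ij)/2`), `Γ₆ = O₆¹`, `ρ = rho (-1) 3`, `L(t) = {x ∈ 𝔬 : tr x = 0, nr x = t}`
(as integer triples `x₁² − 3x₂² − 3x₃² = t`), `Pt(t) = {τ ∈ ℌ : ρ(x)τ = τ for some x ∈ L(t)}` (the points of the special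
`0`-cycle `Z(t)` lifted to `ℌ`), `Γ₆⁺ = N(O₆)⁺ = {g ≠ 0 : gO₆ ⊆ O₆g, nr g > 0}` (`X₆⁺ = X₆/W`), and `Γ₆^{(d)} ⊂ Γ₆⁺` cut
out by `nr g ∈ ℚ^{×2} ∪ dℚ^{×2}` (`X₆^{(d)} = X₆/⟨ω_d⟩`, `d = 2, 3, 6`). All quotients are bare `Quot`s by these relations
(equivalence relations: `specialPoints_equivalence`, `specialPointsPlus_equivalence`, `atkinLehnerQuotient_equivalence`,
`normOne_conj_equivalence`, …). Write `N = N(t) := #(Pt(t)/Γ₆⁺) = |L(t)/N(O₆)|`.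

## The mechanism (the print)

The fibres of `X₆ → X₆⁺ = X₆/W`, `W = {1, ω₂, ω₃, ω₆} ≅ (ℤ/2ℤ)²`, over the image of `Z(t)` are the `W`-orbits in
`Pt(t)/Γ₆`; a non-trivial `ω_d` fixes a class iff the point lies on `Z(t_d)` (`t₂ = 1`, `t₃ = 3`, `t₆ = 6`: Ogg's fixed
points of `w(m)`, «`μ² = −m`», or «`ε = 1 + ζ₄`, if `m = 2`, and `ε = 1 − ζ₃` if `m = 3`»), and `Z(t)` meets `Z(t₀)` only if
`t = c²t₀` (two special vectors at one CM point are proportional — KRY Prop. 3.4.1: «any nonscalar `x ∈ End(A, ι) ⊗ ℚ`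
generates an imaginary quadratic field»), in which case `Z(t) ⊇ Z(t₀)` contributes `#(Pt(t₀)/Γ₆) = 2` fixed classes. Since
`3`, `6` and `2 = 6/3` are not rational squares, AT MOST ONE of `t ∈ ℤ²`, `t ∈ 3ℤ²`, `t ∈ 6ℤ²` holds, so Burnside reads
`#(Pt(t)/Γ₆) = 4N − 2ε(t)` with `ε(t) ∈ {0, 1}` the indicator of `ℤ² ∪ 3ℤ² ∪ 6ℤ²`; with `|L(t)/O₆^×| = #(Pt(t)/Γ₆)` and
`|L(t)/Γ₆| = 2·|L(t)/O₆^×|` (the vectors `x`, `−x` give the same point — KRY (3.4.13) «the vectors `x` and `−x` both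
contribute the same pair of points») this is `|L(t)/Γ₆| = 8N − 4ε(t)`; and the double covers `X₆^{(d)} → X₆⁺` give
`#(Pt(t)/Γ₆^{(d)}) = 2N − ε(t) + ε_d(t)` (`ε_d` the indicator of `t_dℤ²`).

* S. Kudla, M. Rapoport, T. Yang (2006), §3.4: Prop. 3.4.1, (3.4.6) «`4t = n²d`», (3.4.8)–(3.4.13), Remark 3.4.7 («the
  group of Atkin-Lehner involutions permutes the components transitively»). [cite: KudlaRapoportYang2006, §3.4]
* A. P. Ogg (1983), §2 pp. 283–284, (2)–(4): `W ≃ C₂^r`, the fixed points of `w(m)`. [cite: Ogg1983RealPoints, §2]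
* P. Bayer, A. Travesa (2007), §2 («`Γ₆⁺/Γ₆ ≅ (ℤ/2ℤ)²`», the quotients `X₆^{(d)}`, `X₆⁺`), §7 Table 9. [cite: BayerTravesa2007, §2 and §7]
* M.-F. Vignéras (1980), Ch. IV §3 B («`N(O)/O^×ℚ^× ≅ (ℤ/2ℤ)^{2m}`»; `e₂ = e₃ = 2` for `D = 6`). [cite: VignerasLNM800, Ch. IV §3 B]

## What is proved (all `t > 0`, no further hypothesis on `t` unless displayed)

* §1 **`card_specialPoints_eq_four_mul_or_add_two_eq_four_mul`** (`#(Pt(t)/Γ₆) = 4N ∨ #(Pt(t)/Γ₆) + 2 = 4N`),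
  **`card_specialPoints_eq_four_mul_card_specialPointsPlus_iff`** (`= 4N ⟺ t ∉ ℤ² ∪ 3ℤ² ∪ 6ℤ²`: `W` acts freely),
  **`card_specialPoints_add_two_eq_four_mul_card_specialPointsPlus_iff`** (`+ 2 = 4N ⟺ t ∈ ℤ² ∪ 3ℤ² ∪ 6ℤ²`).
* §2 **`two_dvd_card_specialPoints`**, **`four_dvd_card_specialPoints_iff`** (`4 ∣ #(Pt(t)/Γ₆) ⟺ t ∉ ℤ² ∪ 3ℤ² ∪ 6ℤ²`),
  **`card_specialPoints_mod_four_eq_two_iff`** (`≡ 2 (mod 4) ⟺ t ∈ ℤ² ∪ 3ℤ² ∪ 6ℤ²`).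
* §3 vectors: **`card_unit_classes_eq_four_mul_card_normaliser_classes_iff`** ∕ **`…_add_two_…_iff`**,
  **`four_dvd_card_unit_classes_iff`**, **`card_unit_classes_mod_four_eq_two_iff`**,
  **`card_normOne_classes_eq_eight_mul_or_add_four_eq_eight_mul`**, **`eight_dvd_card_normOne_classes_iff`**
  (`8 ∣ |L(t)/Γ₆| ⟺ t ∉ ℤ² ∪ 3ℤ² ∪ 6ℤ²`; g35's `eight_dvd_card_normOne_classes` assumed `3 ∤ t`, `t ≡ 3 (mod 4)`),
  **`card_normOne_classes_mod_eight_eq_four_iff`** (`|L(t)/Γ₆| ≡ 4 (mod 8) ⟺ t ∈ ℤ² ∪ 3ℤ² ∪ 6ℤ²`; e.g. `|L(1)/Γ₆| =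
  |L(3)/Γ₆| = |L(6)/Γ₆| = 4`, `|L(25)/Γ₆| = |L(75)/Γ₆| = 12`, against `8` for `t = 10, 13, 19, 21, 22`).
* §4 the double covers `X₆^{(d)} → X₆⁺`: **`two_mul_card_atkinLehnerQuotient{Two,Three,Six}_add_eq_four_mul_card_specialPointsPlus`**
  (`2·#(Pt(t)/Γ₆^{(2)}) + #((Pt(t) ∩ Pt(3))/Γ₆) + #((Pt(t) ∩ Pt(6))/Γ₆) = 4N`, and cyclically), the closed forms
  **`card_atkinLehnerQuotient{Two,Three,Six}_eq_two_mul_card_specialPointsPlus_of_not_of_not`** (`= 2N`) and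
  **`card_atkinLehnerQuotient{Two,Three,Six}_add_one_eq_two_mul_card_specialPointsPlus_of_*`** (`+ 1 = 2N` exactly when
  `Z(t)` passes through the fixed points of one of the OTHER two involutions), and the parities
  **`odd_card_atkinLehnerQuotientTwo_iff`** (`⟺ t ∈ 3ℤ² ∪ 6ℤ²`), **`odd_card_atkinLehnerQuotientThree_iff`**
  (`⟺ t ∈ ℤ² ∪ 6ℤ²`), **`odd_card_atkinLehnerQuotientSix_iff`** (`⟺ t ∈ ℤ² ∪ 3ℤ²`) — e.g. `t = 1`: `2, 1, 1`; `t = 3`: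
  `1, 2, 1`; `t = 25`: `4, 3, 3`; `t = 75`: `3, 4, 3` (the tables of `…XSixAtkinLehnerQuotientsSpecialPoints`).

## Honest scope

Bookkeeping over the landed counts: no new arithmetic of `B` beyond the exclusivity of the three square shapes; the
statements are about the bare quotient TYPES of the `…XSix…` files (nothing identifies them with the points of algebraic
models of `X₆`, `X₆^{(d)}`, `X₆⁺`), and `N(t)` itself is not computed here (Eichler–Ogg class-number formulas are not in the
tree; the ten values `t ≤ 75` are tabulated in `…XSixPlusSpecialPointsCount`). 0 definitions, 0 named facts, 0 instances.
-/

noncomputable section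

set_option maxSynthPendingDepth 3

open Quaternion Function

namespace Literature.Geometry.Kaehler.ComplexTorus.QuaternionType

/-! ## §0 Helpers: the three square shapes `m²`, `3m²`, `6m²` exclude each other -/

section Helpers

/-- If `a·m² = b·n²` in `ℤ` with `m ≠ 0`, `b ≠ 0`, then `a/b` is a rational square. [folklore] -/
private theorem isSquare_div_of_mul_sq_eq₁₆ {a b m n : ℤ} (hm : m ≠ 0) (hb : b ≠ 0) (h : a * m ^ 2 = b * n ^ 2) :
    IsSquare ((a : ℚ) / b) := by
  have hm' : (m : ℚ) ≠ 0 := by exact_mod_cast hm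
  have hb' : (b : ℚ) ≠ 0 := by exact_mod_cast hb
  have h' : (a : ℚ) * (m : ℚ) ^ 2 = (b : ℚ) * (n : ℚ) ^ 2 := by exact_mod_cast h
  refine ⟨n / m, ?_⟩
  field_simp
  linear_combination h'

/-- `t = a·m² = b·n²`, `t ≠ 0`, is impossible when `a/b` is not a rational square (`b ≠ 0`). [folklore] -/
private theorem false_of_shapes₁₆ {t a b m n : ℤ} (ht : t ≠ 0) (hb : b ≠ 0) (hab : ¬ IsSquare ((a : ℚ) / b))
    (ha : t = a * m ^ 2) (hb' : t = b * n ^ 2) : False := by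
  have hm : m ≠ 0 := by
    rintro rfl
    rw [ha] at ht
    exact ht (by ring)
  exact hab (isSquare_div_of_mul_sq_eq₁₆ hm hb (ha.symm.trans hb'))

/-- `t = m²`, `t ≠ 0` ⟹ `t ≠ 3n²`. [folklore] -/
private theorem not_three_mul_sq_of_sq₁₆ {t m : ℤ} (ht : t ≠ 0) (hm : t = m ^ 2) : ¬ ∃ n : ℤ, t = 3 * n ^ 2 := by
  rintro ⟨n, hn⟩
  exact false_of_shapes₁₆ (a := 1) (b := 3) ht (by norm_num) (by norm_num) (by rw [one_mul]; exact hm) hn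

/-- `t = m²`, `t ≠ 0` ⟹ `t ≠ 6n²`. [folklore] -/
private theorem not_six_mul_sq_of_sq₁₆ {t m : ℤ} (ht : t ≠ 0) (hm : t = m ^ 2) : ¬ ∃ n : ℤ, t = 6 * n ^ 2 := by
  rintro ⟨n, hn⟩
  exact false_of_shapes₁₆ (a := 1) (b := 6) ht (by norm_num) (by norm_num) (by rw [one_mul]; exact hm) hn

/-- `t = 3m²`, `t ≠ 0` ⟹ `t ≠ n²`. [folklore] -/
private theorem not_sq_of_three_mul_sq₁₆ {t m : ℤ} (ht : t ≠ 0) (hm : t = 3 * m ^ 2) : ¬ ∃ n : ℤ, t = n ^ 2 := by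
  rintro ⟨n, hn⟩
  exact not_three_mul_sq_of_sq₁₆ ht hn ⟨m, hm⟩

/-- `t = 3m²`, `t ≠ 0` ⟹ `t ≠ 6n²`. [folklore] -/
private theorem not_six_mul_sq_of_three_mul_sq₁₆ {t m : ℤ} (ht : t ≠ 0) (hm : t = 3 * m ^ 2) :
    ¬ ∃ n : ℤ, t = 6 * n ^ 2 := by
  rintro ⟨n, hn⟩
  exact false_of_shapes₁₆ (a := 3) (b := 6) ht (by norm_num) (by norm_num) hm hn

/-- `t = 6m²`, `t ≠ 0` ⟹ `t ≠ n²`. [folklore] -/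
private theorem not_sq_of_six_mul_sq₁₆ {t m : ℤ} (ht : t ≠ 0) (hm : t = 6 * m ^ 2) : ¬ ∃ n : ℤ, t = n ^ 2 := by
  rintro ⟨n, hn⟩
  exact not_six_mul_sq_of_sq₁₆ ht hn ⟨m, hm⟩

/-- `t = 6m²`, `t ≠ 0` ⟹ `t ≠ 3n²`. [folklore] -/
private theorem not_three_mul_sq_of_six_mul_sq₁₆ {t m : ℤ} (ht : t ≠ 0) (hm : t = 6 * m ^ 2) :
    ¬ ∃ n : ℤ, t = 3 * n ^ 2 := by
  rintro ⟨n, hn⟩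
  exact not_six_mul_sq_of_three_mul_sq₁₆ ht hn ⟨m, hm⟩

/-- An integer `t` with `t = 3c²` (`c ∈ ℚ`) is `3m²`. [folklore] -/
private theorem exists_eq_three_mul_sq_of_rat₁₆ {t : ℤ} {c : ℚ} (h : (t : ℚ) = c ^ 2 * 3) : ∃ m : ℤ, t = 3 * m ^ 2 := by
  have hsq : IsSquare ((3 * t : ℤ) : ℚ) := ⟨3 * c, by push_cast; rw [h]; ring⟩
  obtain ⟨r, hr⟩ := Rat.isSquare_intCast_iff.1 hsq
  have h3 : (3 : ℤ) ∣ r * r := ⟨t, by rw [← hr]⟩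
  obtain ⟨s, rfl⟩ := (Int.prime_three.dvd_mul.1 h3).elim id id
  exact ⟨s, by linarith⟩

/-- An integer `t` with `t = 6c²` (`c ∈ ℚ`) is `6m²`. [folklore] -/
private theorem exists_eq_six_mul_sq_of_rat₁₆ {t : ℤ} {c : ℚ} (h : (t : ℚ) = c ^ 2 * 6) : ∃ m : ℤ, t = 6 * m ^ 2 := by
  have hsq : IsSquare ((6 * t : ℤ) : ℚ) := ⟨6 * c, by push_cast; rw [h]; ring⟩
  obtain ⟨r, hr⟩ := Rat.isSquare_intCast_iff.1 hsq
  have h2 : (2 : ℤ) ∣ r * r := ⟨3 * t, by rw [← hr]; ring⟩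
  obtain ⟨s, rfl⟩ := (Int.prime_two.dvd_mul.1 h2).elim id id
  have h3' : (3 : ℤ) ∣ 2 * (s * s) := ⟨t, by linarith⟩
  have h3 : (3 : ℤ) ∣ s * s := (Int.prime_three.dvd_mul.1 h3').resolve_left (by norm_num)
  obtain ⟨u, rfl⟩ := (Int.prime_three.dvd_mul.1 h3).elim id id
  exact ⟨u, by linarith⟩

/-- An integer which is a rational square is a perfect square. [folklore] -/
private theorem exists_eq_sq_of_rat₁₆ {t : ℤ} {c : ℚ} (h : (t : ℚ) = c ^ 2 * 1) : ∃ m : ℤ, t = m ^ 2 := by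
  have hsq : IsSquare ((t : ℤ) : ℚ) := ⟨c, by rw [h, mul_one, sq]⟩
  obtain ⟨m, hm⟩ := Rat.isSquare_intCast_iff.1 hsq
  exact ⟨m, by rw [hm, sq]⟩

/-- `t ∉ ℤ² ⟹ t ∉ ℚ²·1` (as used by `card_specialPoints_inter_eq_zero`). [folklore] -/
private theorem not_rat_sq_one₁₆ {t : ℤ} (h : ¬ ∃ m : ℤ, t = m ^ 2) : ¬ ∃ c : ℚ, (t : ℚ) = c ^ 2 * ((1 : ℤ) : ℚ) := by
  rintro ⟨c, hc⟩
  rw [Int.cast_one] at hc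
  exact h (exists_eq_sq_of_rat₁₆ hc)

/-- `t ∉ 3ℤ² ⟹ t ∉ ℚ²·3`. [folklore] -/
private theorem not_rat_sq_three₁₆ {t : ℤ} (h : ¬ ∃ m : ℤ, t = 3 * m ^ 2) :
    ¬ ∃ c : ℚ, (t : ℚ) = c ^ 2 * ((3 : ℤ) : ℚ) := by
  rintro ⟨c, hc⟩
  rw [show ((3 : ℤ) : ℚ) = 3 by norm_num] at hc
  exact h (exists_eq_three_mul_sq_of_rat₁₆ hc)

/-- `t ∉ 6ℤ² ⟹ t ∉ ℚ²·6`. [folklore] -/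
private theorem not_rat_sq_six₁₆ {t : ℤ} (h : ¬ ∃ m : ℤ, t = 6 * m ^ 2) :
    ¬ ∃ c : ℚ, (t : ℚ) = c ^ 2 * ((6 : ℤ) : ℚ) := by
  rintro ⟨c, hc⟩
  rw [show ((6 : ℤ) : ℚ) = 6 by norm_num] at hc
  exact h (exists_eq_six_mul_sq_of_rat₁₆ hc)

end Helpers

/-! ## §1 The dichotomy `#(Pt(t)/Γ₆) ∈ {4N, 4N − 2}` and when each case occurs -/

section Dichotomy

/-- **DICHOTOMY, EVERY `t > 0`: `#(Pt(t)/Γ₆) = 4·#(Pt(t)/Γ₆⁺)` or `#(Pt(t)/Γ₆) + 2 = 4·#(Pt(t)/Γ₆⁺)`** — the Klein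
four-group `W` on the points of `Z(t)` on `X₆` has all orbits of size `4`, except the single orbit of the two `Z(1)`-,
`Z(3)`- or `Z(6)`-points when `Z(t)` contains them. [cite: KudlaRapoportYang2006, §3.4 Remark 3.4.7 and (3.4.13)] [cite: Ogg1983RealPoints, §2 (2)–(4)] [cite: BayerTravesa2007, §2] -/
theorem card_specialPoints_eq_four_mul_or_add_two_eq_four_mul {t : ℤ} (ht : 0 < t) :
    Nat.card (Quot (fun p q : {τ : ℂ // 0 < τ.im ∧ ∃ x : ℍ[ℚ,((-1 : ℤ) : ℚ),((3 : ℤ) : ℚ)],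
        x ∈ order (-1) 3 ∧ x.re = 0 ∧ (x * star x).re = t ∧ moebius (rho (-1) 3 (by norm_num) (castQ (-1) 3 x)) τ = τ} ↦
      ∃ v : ℍ[ℚ,((-1 : ℤ) : ℚ),((3 : ℤ) : ℚ)], (v ∈ order (-1) 3 ∨ v - ⟨1/2, 1/2, 1/2, -1/2⟩ ∈ order (-1) 3) ∧
        v * star v = 1 ∧ moebius (rho (-1) 3 (by norm_num) (castQ (-1) 3 v)) p.1 = q.1)) =
    4 * Nat.card (Quot (fun p q : {τ : ℂ // 0 < τ.im ∧ ∃ x : ℍ[ℚ,((-1 : ℤ) : ℚ),((3 : ℤ) : ℚ)],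
        x ∈ order (-1) 3 ∧ x.re = 0 ∧ (x * star x).re = t ∧ moebius (rho (-1) 3 (by norm_num) (castQ (-1) 3 x)) τ = τ} ↦
      ∃ g : ℍ[ℚ,((-1 : ℤ) : ℚ),((3 : ℤ) : ℚ)], g ≠ 0 ∧
        (∀ a : ℍ[ℚ,((-1 : ℤ) : ℚ),((3 : ℤ) : ℚ)], (a ∈ order (-1) 3 ∨ a - ⟨1/2, 1/2, 1/2, -1/2⟩ ∈ order (-1) 3) →
          ∃ b : ℍ[ℚ,((-1 : ℤ) : ℚ),((3 : ℤ) : ℚ)], (b ∈ order (-1) 3 ∨ b - ⟨1/2, 1/2, 1/2, -1/2⟩ ∈ order (-1) 3) ∧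
            g * a = b * g) ∧
        0 < (g * star g).re ∧ moebius (rho (-1) 3 (by norm_num) (castQ (-1) 3 g)) p.1 = q.1)) ∨
    Nat.card (Quot (fun p q : {τ : ℂ // 0 < τ.im ∧ ∃ x : ℍ[ℚ,((-1 : ℤ) : ℚ),((3 : ℤ) : ℚ)],
        x ∈ order (-1) 3 ∧ x.re = 0 ∧ (x * star x).re = t ∧ moebius (rho (-1) 3 (by norm_num) (castQ (-1) 3 x)) τ = τ} ↦
      ∃ v : ℍ[ℚ,((-1 : ℤ) : ℚ),((3 : ℤ) : ℚ)], (v ∈ order (-1) 3 ∨ v - ⟨1/2, 1/2, 1/2, -1/2⟩ ∈ order (-1) 3) ∧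
        v * star v = 1 ∧ moebius (rho (-1) 3 (by norm_num) (castQ (-1) 3 v)) p.1 = q.1)) + 2 =
    4 * Nat.card (Quot (fun p q : {τ : ℂ // 0 < τ.im ∧ ∃ x : ℍ[ℚ,((-1 : ℤ) : ℚ),((3 : ℤ) : ℚ)],
        x ∈ order (-1) 3 ∧ x.re = 0 ∧ (x * star x).re = t ∧ moebius (rho (-1) 3 (by norm_num) (castQ (-1) 3 x)) τ = τ} ↦
      ∃ g : ℍ[ℚ,((-1 : ℤ) : ℚ),((3 : ℤ) : ℚ)], g ≠ 0 ∧
        (∀ a : ℍ[ℚ,((-1 : ℤ) : ℚ),((3 : ℤ) : ℚ)], (a ∈ order (-1) 3 ∨ a - ⟨1/2, 1/2, 1/2, -1/2⟩ ∈ order (-1) 3) →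
          ∃ b : ℍ[ℚ,((-1 : ℤ) : ℚ),((3 : ℤ) : ℚ)], (b ∈ order (-1) 3 ∨ b - ⟨1/2, 1/2, 1/2, -1/2⟩ ∈ order (-1) 3) ∧
            g * a = b * g) ∧
        0 < (g * star g).re ∧ moebius (rho (-1) 3 (by norm_num) (castQ (-1) 3 g)) p.1 = q.1)) := by
  by_cases h1 : ∃ m : ℤ, t = m ^ 2
  · obtain ⟨m, hm⟩ := h1
    exact Or.inr (card_specialPoints_add_two_eq_four_mul_card_specialPointsPlus_of_sq ht hm).1
  by_cases h3 : ∃ m : ℤ, t = 3 * m ^ 2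
  · obtain ⟨m, hm⟩ := h3
    exact Or.inr (card_specialPoints_add_two_eq_four_mul_card_specialPointsPlus_of_three_mul_sq ht hm).1
  by_cases h6 : ∃ m : ℤ, t = 6 * m ^ 2
  · obtain ⟨m, hm⟩ := h6
    exact Or.inr (card_specialPoints_add_two_eq_four_mul_card_specialPointsPlus_of_six_mul_sq ht hm).1
  exact Or.inl (card_specialPoints_eq_four_mul_card_specialPointsPlus_of_generic ht h1 h3 h6).1

/-- **`#(Pt(t)/Γ₆) + 2 = 4·#(Pt(t)/Γ₆⁺)` IFF `t ∈ ℤ² ∪ 3ℤ² ∪ 6ℤ²`** (`t > 0`) — iff `Z(t)` passes through the fixed points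
of one of `ω₂, ω₃, ω₆` (the `Z(1)`-, `Z(3)`-, `Z(6)`-points). [cite: Ogg1983RealPoints, §2 p. 284 and (3)–(4)] [cite: KudlaRapoportYang2006, §3.4 (3.4.6) and Remark 3.4.7] [cite: BayerTravesa2007, §1 Thm. 1.1 and §2] -/
theorem card_specialPoints_add_two_eq_four_mul_card_specialPointsPlus_iff {t : ℤ} (ht : 0 < t) :
    Nat.card (Quot (fun p q : {τ : ℂ // 0 < τ.im ∧ ∃ x : ℍ[ℚ,((-1 : ℤ) : ℚ),((3 : ℤ) : ℚ)],
        x ∈ order (-1) 3 ∧ x.re = 0 ∧ (x * star x).re = t ∧ moebius (rho (-1) 3 (by norm_num) (castQ (-1) 3 x)) τ = τ} ↦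
      ∃ v : ℍ[ℚ,((-1 : ℤ) : ℚ),((3 : ℤ) : ℚ)], (v ∈ order (-1) 3 ∨ v - ⟨1/2, 1/2, 1/2, -1/2⟩ ∈ order (-1) 3) ∧
        v * star v = 1 ∧ moebius (rho (-1) 3 (by norm_num) (castQ (-1) 3 v)) p.1 = q.1)) + 2 =
    4 * Nat.card (Quot (fun p q : {τ : ℂ // 0 < τ.im ∧ ∃ x : ℍ[ℚ,((-1 : ℤ) : ℚ),((3 : ℤ) : ℚ)],
        x ∈ order (-1) 3 ∧ x.re = 0 ∧ (x * star x).re = t ∧ moebius (rho (-1) 3 (by norm_num) (castQ (-1) 3 x)) τ = τ} ↦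
      ∃ g : ℍ[ℚ,((-1 : ℤ) : ℚ),((3 : ℤ) : ℚ)], g ≠ 0 ∧
        (∀ a : ℍ[ℚ,((-1 : ℤ) : ℚ),((3 : ℤ) : ℚ)], (a ∈ order (-1) 3 ∨ a - ⟨1/2, 1/2, 1/2, -1/2⟩ ∈ order (-1) 3) →
          ∃ b : ℍ[ℚ,((-1 : ℤ) : ℚ),((3 : ℤ) : ℚ)], (b ∈ order (-1) 3 ∨ b - ⟨1/2, 1/2, 1/2, -1/2⟩ ∈ order (-1) 3) ∧
            g * a = b * g) ∧
        0 < (g * star g).re ∧ moebius (rho (-1) 3 (by norm_num) (castQ (-1) 3 g)) p.1 = q.1)) ↔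
    ∃ m : ℤ, t = m ^ 2 ∨ t = 3 * m ^ 2 ∨ t = 6 * m ^ 2 := by
  constructor
  · intro h
    by_contra hne
    have h1 : ¬ ∃ m : ℤ, t = m ^ 2 := fun ⟨m, hm⟩ ↦ hne ⟨m, Or.inl hm⟩
    have h3 : ¬ ∃ m : ℤ, t = 3 * m ^ 2 := fun ⟨m, hm⟩ ↦ hne ⟨m, Or.inr (Or.inl hm)⟩
    have h6 : ¬ ∃ m : ℤ, t = 6 * m ^ 2 := fun ⟨m, hm⟩ ↦ hne ⟨m, Or.inr (Or.inr hm)⟩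
    have key := (card_specialPoints_eq_four_mul_card_specialPointsPlus_of_generic ht h1 h3 h6).1
    omega
  · rintro ⟨m, hm | hm | hm⟩
    · exact (card_specialPoints_add_two_eq_four_mul_card_specialPointsPlus_of_sq ht hm).1
    · exact (card_specialPoints_add_two_eq_four_mul_card_specialPointsPlus_of_three_mul_sq ht hm).1
    · exact (card_specialPoints_add_two_eq_four_mul_card_specialPointsPlus_of_six_mul_sq ht hm).1

/-- **`#(Pt(t)/Γ₆) = 4·#(Pt(t)/Γ₆⁺)` IFF `t ∉ ℤ² ∪ 3ℤ² ∪ 6ℤ²`** (`t > 0`) — iff `W ≅ (ℤ/2ℤ)²` acts FREELY on the points of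
`Z(t)` on `X₆`. [cite: KudlaRapoportYang2006, §3.4 Remark 3.4.7 («permutes the components transitively»)] [cite: Ogg1983RealPoints, §2 (2)–(4)] [cite: BayerTravesa2007, §2] -/
theorem card_specialPoints_eq_four_mul_card_specialPointsPlus_iff {t : ℤ} (ht : 0 < t) :
    Nat.card (Quot (fun p q : {τ : ℂ // 0 < τ.im ∧ ∃ x : ℍ[ℚ,((-1 : ℤ) : ℚ),((3 : ℤ) : ℚ)],
        x ∈ order (-1) 3 ∧ x.re = 0 ∧ (x * star x).re = t ∧ moebius (rho (-1) 3 (by norm_num) (castQ (-1) 3 x)) τ = τ} ↦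
      ∃ v : ℍ[ℚ,((-1 : ℤ) : ℚ),((3 : ℤ) : ℚ)], (v ∈ order (-1) 3 ∨ v - ⟨1/2, 1/2, 1/2, -1/2⟩ ∈ order (-1) 3) ∧
        v * star v = 1 ∧ moebius (rho (-1) 3 (by norm_num) (castQ (-1) 3 v)) p.1 = q.1)) =
    4 * Nat.card (Quot (fun p q : {τ : ℂ // 0 < τ.im ∧ ∃ x : ℍ[ℚ,((-1 : ℤ) : ℚ),((3 : ℤ) : ℚ)],
        x ∈ order (-1) 3 ∧ x.re = 0 ∧ (x * star x).re = t ∧ moebius (rho (-1) 3 (by norm_num) (castQ (-1) 3 x)) τ = τ} ↦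
      ∃ g : ℍ[ℚ,((-1 : ℤ) : ℚ),((3 : ℤ) : ℚ)], g ≠ 0 ∧
        (∀ a : ℍ[ℚ,((-1 : ℤ) : ℚ),((3 : ℤ) : ℚ)], (a ∈ order (-1) 3 ∨ a - ⟨1/2, 1/2, 1/2, -1/2⟩ ∈ order (-1) 3) →
          ∃ b : ℍ[ℚ,((-1 : ℤ) : ℚ),((3 : ℤ) : ℚ)], (b ∈ order (-1) 3 ∨ b - ⟨1/2, 1/2, 1/2, -1/2⟩ ∈ order (-1) 3) ∧
            g * a = b * g) ∧
        0 < (g * star g).re ∧ moebius (rho (-1) 3 (by norm_num) (castQ (-1) 3 g)) p.1 = q.1)) ↔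
    ¬ ∃ m : ℤ, t = m ^ 2 ∨ t = 3 * m ^ 2 ∨ t = 6 * m ^ 2 := by
  constructor
  · intro h hany
    have key := (card_specialPoints_add_two_eq_four_mul_card_specialPointsPlus_iff ht).2 hany
    omega
  · intro hne
    have h1 : ¬ ∃ m : ℤ, t = m ^ 2 := fun ⟨m, hm⟩ ↦ hne ⟨m, Or.inl hm⟩
    have h3 : ¬ ∃ m : ℤ, t = 3 * m ^ 2 := fun ⟨m, hm⟩ ↦ hne ⟨m, Or.inr (Or.inl hm)⟩
    have h6 : ¬ ∃ m : ℤ, t = 6 * m ^ 2 := fun ⟨m, hm⟩ ↦ hne ⟨m, Or.inr (Or.inr hm)⟩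
    exact (card_specialPoints_eq_four_mul_card_specialPointsPlus_of_generic ht h1 h3 h6).1

/-- In the second case `Z(t)` is non-empty on `X₆⁺`: **`t ∈ ℤ² ∪ 3ℤ² ∪ 6ℤ² ⟹ 0 < #(Pt(t)/Γ₆⁺)`** (`Z(t) ⊇ Z(1), Z(3)` or
`Z(6)`, each non-empty). [cite: KudlaRapoportYang2006, §3.4 Prop. 3.4.5 and (3.4.6)] -/
theorem card_specialPointsPlus_pos_of_sq_shape {t : ℤ} (ht : 0 < t)
    (h : ∃ m : ℤ, t = m ^ 2 ∨ t = 3 * m ^ 2 ∨ t = 6 * m ^ 2) :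
    0 < Nat.card (Quot (fun p q : {τ : ℂ // 0 < τ.im ∧ ∃ x : ℍ[ℚ,((-1 : ℤ) : ℚ),((3 : ℤ) : ℚ)],
        x ∈ order (-1) 3 ∧ x.re = 0 ∧ (x * star x).re = t ∧ moebius (rho (-1) 3 (by norm_num) (castQ (-1) 3 x)) τ = τ} ↦
      ∃ g : ℍ[ℚ,((-1 : ℤ) : ℚ),((3 : ℤ) : ℚ)], g ≠ 0 ∧
        (∀ a : ℍ[ℚ,((-1 : ℤ) : ℚ),((3 : ℤ) : ℚ)], (a ∈ order (-1) 3 ∨ a - ⟨1/2, 1/2, 1/2, -1/2⟩ ∈ order (-1) 3) →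
          ∃ b : ℍ[ℚ,((-1 : ℤ) : ℚ),((3 : ℤ) : ℚ)], (b ∈ order (-1) 3 ∨ b - ⟨1/2, 1/2, 1/2, -1/2⟩ ∈ order (-1) 3) ∧
            g * a = b * g) ∧
        0 < (g * star g).re ∧ moebius (rho (-1) 3 (by norm_num) (castQ (-1) 3 g)) p.1 = q.1)) := by
  have key := (card_specialPoints_add_two_eq_four_mul_card_specialPointsPlus_iff ht).2 h
  omega

end Dichotomy

/-! ## §2 Congruences for `#(Pt(t)/Γ₆)`: always even; `≡ 0` or `2 (mod 4)` according to the shape of `t` -/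

section Congruences

/-- **`#(Pt(t)/Γ₆)` IS EVEN for every `t > 0`** (`4N` or `4N − 2`). [cite: KudlaRapoportYang2006, §3.4 (3.4.13)] [cite: Ogg1983RealPoints, §2 (2)–(4)] -/
theorem two_dvd_card_specialPoints {t : ℤ} (ht : 0 < t) :
    2 ∣ Nat.card (Quot (fun p q : {τ : ℂ // 0 < τ.im ∧ ∃ x : ℍ[ℚ,((-1 : ℤ) : ℚ),((3 : ℤ) : ℚ)],
        x ∈ order (-1) 3 ∧ x.re = 0 ∧ (x * star x).re = t ∧ moebius (rho (-1) 3 (by norm_num) (castQ (-1) 3 x)) τ = τ} ↦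
      ∃ v : ℍ[ℚ,((-1 : ℤ) : ℚ),((3 : ℤ) : ℚ)], (v ∈ order (-1) 3 ∨ v - ⟨1/2, 1/2, 1/2, -1/2⟩ ∈ order (-1) 3) ∧
        v * star v = 1 ∧ moebius (rho (-1) 3 (by norm_num) (castQ (-1) 3 v)) p.1 = q.1)) := by
  rcases card_specialPoints_eq_four_mul_or_add_two_eq_four_mul ht with h | h <;> omega

/-- **`4 ∣ #(Pt(t)/Γ₆)` IFF `t ∉ ℤ² ∪ 3ℤ² ∪ 6ℤ²`** (`t > 0`). [cite: KudlaRapoportYang2006, §3.4 Remark 3.4.7 and (3.4.13)] [cite: Ogg1983RealPoints, §2 (2)–(4)] [cite: BayerTravesa2007, §2] -/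
theorem four_dvd_card_specialPoints_iff {t : ℤ} (ht : 0 < t) :
    4 ∣ Nat.card (Quot (fun p q : {τ : ℂ // 0 < τ.im ∧ ∃ x : ℍ[ℚ,((-1 : ℤ) : ℚ),((3 : ℤ) : ℚ)],
        x ∈ order (-1) 3 ∧ x.re = 0 ∧ (x * star x).re = t ∧ moebius (rho (-1) 3 (by norm_num) (castQ (-1) 3 x)) τ = τ} ↦
      ∃ v : ℍ[ℚ,((-1 : ℤ) : ℚ),((3 : ℤ) : ℚ)], (v ∈ order (-1) 3 ∨ v - ⟨1/2, 1/2, 1/2, -1/2⟩ ∈ order (-1) 3) ∧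
        v * star v = 1 ∧ moebius (rho (-1) 3 (by norm_num) (castQ (-1) 3 v)) p.1 = q.1)) ↔
    ¬ ∃ m : ℤ, t = m ^ 2 ∨ t = 3 * m ^ 2 ∨ t = 6 * m ^ 2 := by
  constructor
  · rintro ⟨k, hk⟩ hany
    have key := (card_specialPoints_add_two_eq_four_mul_card_specialPointsPlus_iff ht).2 hany
    omega
  · intro hne
    exact ⟨_, (card_specialPoints_eq_four_mul_card_specialPointsPlus_iff ht).2 hne⟩

/-- **`#(Pt(t)/Γ₆) ≡ 2 (mod 4)` IFF `t ∈ ℤ² ∪ 3ℤ² ∪ 6ℤ²`** (`t > 0`; then `#(Pt(t)/Γ₆) = 4N − 2 ≥ 2`). [cite: KudlaRapoportYang2006, §3.4 Remark 3.4.7 and (3.4.13)] [cite: Ogg1983RealPoints, §2 (2)–(4)] [cite: BayerTravesa2007, §1 Thm. 1.1 and §2] -/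
theorem card_specialPoints_mod_four_eq_two_iff {t : ℤ} (ht : 0 < t) :
    Nat.card (Quot (fun p q : {τ : ℂ // 0 < τ.im ∧ ∃ x : ℍ[ℚ,((-1 : ℤ) : ℚ),((3 : ℤ) : ℚ)],
        x ∈ order (-1) 3 ∧ x.re = 0 ∧ (x * star x).re = t ∧ moebius (rho (-1) 3 (by norm_num) (castQ (-1) 3 x)) τ = τ} ↦
      ∃ v : ℍ[ℚ,((-1 : ℤ) : ℚ),((3 : ℤ) : ℚ)], (v ∈ order (-1) 3 ∨ v - ⟨1/2, 1/2, 1/2, -1/2⟩ ∈ order (-1) 3) ∧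
        v * star v = 1 ∧ moebius (rho (-1) 3 (by norm_num) (castQ (-1) 3 v)) p.1 = q.1)) % 4 = 2 ↔
    ∃ m : ℤ, t = m ^ 2 ∨ t = 3 * m ^ 2 ∨ t = 6 * m ^ 2 := by
  constructor
  · intro h
    by_contra hne
    have key := (card_specialPoints_eq_four_mul_card_specialPointsPlus_iff ht).2 hne
    omega
  · intro hany
    have key := (card_specialPoints_add_two_eq_four_mul_card_specialPointsPlus_iff ht).2 hany
    omega

end Congruences

/-! ## §3 The vectors side: `|L(t)/O₆^×| ∈ {4N, 4N − 2}`, `|L(t)/Γ₆| ∈ {8N, 8N − 4}`, `N = |L(t)/N(O₆)|` -/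

section Vectors

/-- **`|L(t)/O₆^×| = 4·|L(t)/N(O₆)|` IFF `t ∉ ℤ² ∪ 3ℤ² ∪ 6ℤ²`** (`t > 0`) — `N(O₆)/ℚ^×O₆^× ≅ (ℤ/2ℤ)²` acts freely on the
`O₆^×`-classes of `L(t)`. [cite: VignerasLNM800, Ch. IV §3 B] [cite: KudlaRapoportYang2006, §3.4 Remark 3.4.7] [cite: Ogg1983RealPoints, §2 (2)–(4)] -/
theorem card_unit_classes_eq_four_mul_card_normaliser_classes_iff {t : ℤ} (ht : 0 < t) :
    Nat.card (Quot (fun x y : {x : ℤ × ℤ × ℤ // x.1 ^ 2 - 3 * x.2.1 ^ 2 - 3 * x.2.2 ^ 2 = t} ↦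
      ∃ v : ℍ[ℚ,((-1 : ℤ) : ℚ),((3 : ℤ) : ℚ)], (v ∈ order (-1) 3 ∨ v - ⟨1/2, 1/2, 1/2, -1/2⟩ ∈ order (-1) 3) ∧
        ((v * star v).re = 1 ∨ (v * star v).re = -1) ∧
        v * ⟨0, x.1.1, x.1.2.1, x.1.2.2⟩ = ⟨0, y.1.1, y.1.2.1, y.1.2.2⟩ * v)) =
    4 * Nat.card (Quot (fun x y : {x : ℤ × ℤ × ℤ // x.1 ^ 2 - 3 * x.2.1 ^ 2 - 3 * x.2.2 ^ 2 = t} ↦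
      ∃ g : ℍ[ℚ,((-1 : ℤ) : ℚ),((3 : ℤ) : ℚ)], g ≠ 0 ∧
        (∀ a : ℍ[ℚ,((-1 : ℤ) : ℚ),((3 : ℤ) : ℚ)], (a ∈ order (-1) 3 ∨ a - ⟨1/2, 1/2, 1/2, -1/2⟩ ∈ order (-1) 3) →
          ∃ b : ℍ[ℚ,((-1 : ℤ) : ℚ),((3 : ℤ) : ℚ)], (b ∈ order (-1) 3 ∨ b - ⟨1/2, 1/2, 1/2, -1/2⟩ ∈ order (-1) 3) ∧
            g * a = b * g) ∧
        g * ⟨0, x.1.1, x.1.2.1, x.1.2.2⟩ = ⟨0, y.1.1, y.1.2.1, y.1.2.2⟩ * g)) ↔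
    ¬ ∃ m : ℤ, t = m ^ 2 ∨ t = 3 * m ^ 2 ∨ t = 6 * m ^ 2 := by
  rw [← card_specialPoints_eq_card_unit_classes ht, ← card_specialPointsPlus_eq_card_normaliser_classes_all ht]
  exact card_specialPoints_eq_four_mul_card_specialPointsPlus_iff ht

/-- **`|L(t)/O₆^×| + 2 = 4·|L(t)/N(O₆)|` IFF `t ∈ ℤ² ∪ 3ℤ² ∪ 6ℤ²`** (`t > 0`). [cite: VignerasLNM800, Ch. IV §3 B] [cite: KudlaRapoportYang2006, §3.4 Remark 3.4.7 and (3.4.6)] [cite: Ogg1983RealPoints, §2 (2)–(4)] -/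
theorem card_unit_classes_add_two_eq_four_mul_card_normaliser_classes_iff {t : ℤ} (ht : 0 < t) :
    Nat.card (Quot (fun x y : {x : ℤ × ℤ × ℤ // x.1 ^ 2 - 3 * x.2.1 ^ 2 - 3 * x.2.2 ^ 2 = t} ↦
      ∃ v : ℍ[ℚ,((-1 : ℤ) : ℚ),((3 : ℤ) : ℚ)], (v ∈ order (-1) 3 ∨ v - ⟨1/2, 1/2, 1/2, -1/2⟩ ∈ order (-1) 3) ∧
        ((v * star v).re = 1 ∨ (v * star v).re = -1) ∧
        v * ⟨0, x.1.1, x.1.2.1, x.1.2.2⟩ = ⟨0, y.1.1, y.1.2.1, y.1.2.2⟩ * v)) + 2 =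
    4 * Nat.card (Quot (fun x y : {x : ℤ × ℤ × ℤ // x.1 ^ 2 - 3 * x.2.1 ^ 2 - 3 * x.2.2 ^ 2 = t} ↦
      ∃ g : ℍ[ℚ,((-1 : ℤ) : ℚ),((3 : ℤ) : ℚ)], g ≠ 0 ∧
        (∀ a : ℍ[ℚ,((-1 : ℤ) : ℚ),((3 : ℤ) : ℚ)], (a ∈ order (-1) 3 ∨ a - ⟨1/2, 1/2, 1/2, -1/2⟩ ∈ order (-1) 3) →
          ∃ b : ℍ[ℚ,((-1 : ℤ) : ℚ),((3 : ℤ) : ℚ)], (b ∈ order (-1) 3 ∨ b - ⟨1/2, 1/2, 1/2, -1/2⟩ ∈ order (-1) 3) ∧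
            g * a = b * g) ∧
        g * ⟨0, x.1.1, x.1.2.1, x.1.2.2⟩ = ⟨0, y.1.1, y.1.2.1, y.1.2.2⟩ * g)) ↔
    ∃ m : ℤ, t = m ^ 2 ∨ t = 3 * m ^ 2 ∨ t = 6 * m ^ 2 := by
  rw [← card_specialPoints_eq_card_unit_classes ht, ← card_specialPointsPlus_eq_card_normaliser_classes_all ht]
  exact card_specialPoints_add_two_eq_four_mul_card_specialPointsPlus_iff ht

/-- **`4 ∣ |L(t)/O₆^×|` IFF `t ∉ ℤ² ∪ 3ℤ² ∪ 6ℤ²`** (`t > 0`; g35's `four_dvd_card_unit_classes` had `3 ∤ t`,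
`t ≡ 3 (mod 4)`). [cite: VignerasLNM800, Ch. IV §3 B] [cite: KudlaRapoportYang2006, §3.4 Remark 3.4.7 and (3.4.13)] -/
theorem four_dvd_card_unit_classes_iff {t : ℤ} (ht : 0 < t) :
    4 ∣ Nat.card (Quot (fun x y : {x : ℤ × ℤ × ℤ // x.1 ^ 2 - 3 * x.2.1 ^ 2 - 3 * x.2.2 ^ 2 = t} ↦
      ∃ v : ℍ[ℚ,((-1 : ℤ) : ℚ),((3 : ℤ) : ℚ)], (v ∈ order (-1) 3 ∨ v - ⟨1/2, 1/2, 1/2, -1/2⟩ ∈ order (-1) 3) ∧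
        ((v * star v).re = 1 ∨ (v * star v).re = -1) ∧
        v * ⟨0, x.1.1, x.1.2.1, x.1.2.2⟩ = ⟨0, y.1.1, y.1.2.1, y.1.2.2⟩ * v)) ↔
    ¬ ∃ m : ℤ, t = m ^ 2 ∨ t = 3 * m ^ 2 ∨ t = 6 * m ^ 2 := by
  rw [← card_specialPoints_eq_card_unit_classes ht]
  exact four_dvd_card_specialPoints_iff ht

/-- **`|L(t)/O₆^×| ≡ 2 (mod 4)` IFF `t ∈ ℤ² ∪ 3ℤ² ∪ 6ℤ²`** (`t > 0`). [cite: VignerasLNM800, Ch. IV §3 B] [cite: KudlaRapoportYang2006, §3.4 Remark 3.4.7 and (3.4.13)] -/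
theorem card_unit_classes_mod_four_eq_two_iff {t : ℤ} (ht : 0 < t) :
    Nat.card (Quot (fun x y : {x : ℤ × ℤ × ℤ // x.1 ^ 2 - 3 * x.2.1 ^ 2 - 3 * x.2.2 ^ 2 = t} ↦
      ∃ v : ℍ[ℚ,((-1 : ℤ) : ℚ),((3 : ℤ) : ℚ)], (v ∈ order (-1) 3 ∨ v - ⟨1/2, 1/2, 1/2, -1/2⟩ ∈ order (-1) 3) ∧
        ((v * star v).re = 1 ∨ (v * star v).re = -1) ∧
        v * ⟨0, x.1.1, x.1.2.1, x.1.2.2⟩ = ⟨0, y.1.1, y.1.2.1, y.1.2.2⟩ * v)) % 4 = 2 ↔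
    ∃ m : ℤ, t = m ^ 2 ∨ t = 3 * m ^ 2 ∨ t = 6 * m ^ 2 := by
  rw [← card_specialPoints_eq_card_unit_classes ht]
  exact card_specialPoints_mod_four_eq_two_iff ht

/-- **DICHOTOMY FOR KRY's `|L(t)/Γ|`, `Γ = O₆¹`, EVERY `t > 0`: `|L(t)/Γ₆| = 8·|L(t)/N(O₆)|` or
`|L(t)/Γ₆| + 4 = 8·|L(t)/N(O₆)|`** (`|L(t)/Γ₆| = 2·|L(t)/O₆^×|`: `x` and `−x` are never `Γ₆`-conjugate).
[cite: KudlaRapoportYang2006, §3.4 (3.4.11)–(3.4.13)] [cite: VignerasLNM800, Ch. IV §3 B] [cite: Ogg1983RealPoints, §2 (2)–(4)] -/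
theorem card_normOne_classes_eq_eight_mul_or_add_four_eq_eight_mul {t : ℤ} (ht : 0 < t) :
    Nat.card (Quot (fun x y : {x : ℤ × ℤ × ℤ // x.1 ^ 2 - 3 * x.2.1 ^ 2 - 3 * x.2.2 ^ 2 = t} ↦
      ∃ u : ℍ[ℚ,((-1 : ℤ) : ℚ),((3 : ℤ) : ℚ)], (u ∈ order (-1) 3 ∨ u - ⟨1/2, 1/2, 1/2, -1/2⟩ ∈ order (-1) 3) ∧
        (u * star u).re = 1 ∧ u * ⟨0, x.1.1, x.1.2.1, x.1.2.2⟩ = ⟨0, y.1.1, y.1.2.1, y.1.2.2⟩ * u)) =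
    8 * Nat.card (Quot (fun x y : {x : ℤ × ℤ × ℤ // x.1 ^ 2 - 3 * x.2.1 ^ 2 - 3 * x.2.2 ^ 2 = t} ↦
      ∃ g : ℍ[ℚ,((-1 : ℤ) : ℚ),((3 : ℤ) : ℚ)], g ≠ 0 ∧
        (∀ a : ℍ[ℚ,((-1 : ℤ) : ℚ),((3 : ℤ) : ℚ)], (a ∈ order (-1) 3 ∨ a - ⟨1/2, 1/2, 1/2, -1/2⟩ ∈ order (-1) 3) →
          ∃ b : ℍ[ℚ,((-1 : ℤ) : ℚ),((3 : ℤ) : ℚ)], (b ∈ order (-1) 3 ∨ b - ⟨1/2, 1/2, 1/2, -1/2⟩ ∈ order (-1) 3) ∧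
            g * a = b * g) ∧
        g * ⟨0, x.1.1, x.1.2.1, x.1.2.2⟩ = ⟨0, y.1.1, y.1.2.1, y.1.2.2⟩ * g)) ∨
    Nat.card (Quot (fun x y : {x : ℤ × ℤ × ℤ // x.1 ^ 2 - 3 * x.2.1 ^ 2 - 3 * x.2.2 ^ 2 = t} ↦
      ∃ u : ℍ[ℚ,((-1 : ℤ) : ℚ),((3 : ℤ) : ℚ)], (u ∈ order (-1) 3 ∨ u - ⟨1/2, 1/2, 1/2, -1/2⟩ ∈ order (-1) 3) ∧
        (u * star u).re = 1 ∧ u * ⟨0, x.1.1, x.1.2.1, x.1.2.2⟩ = ⟨0, y.1.1, y.1.2.1, y.1.2.2⟩ * u)) + 4 =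
    8 * Nat.card (Quot (fun x y : {x : ℤ × ℤ × ℤ // x.1 ^ 2 - 3 * x.2.1 ^ 2 - 3 * x.2.2 ^ 2 = t} ↦
      ∃ g : ℍ[ℚ,((-1 : ℤ) : ℚ),((3 : ℤ) : ℚ)], g ≠ 0 ∧
        (∀ a : ℍ[ℚ,((-1 : ℤ) : ℚ),((3 : ℤ) : ℚ)], (a ∈ order (-1) 3 ∨ a - ⟨1/2, 1/2, 1/2, -1/2⟩ ∈ order (-1) 3) →
          ∃ b : ℍ[ℚ,((-1 : ℤ) : ℚ),((3 : ℤ) : ℚ)], (b ∈ order (-1) 3 ∨ b - ⟨1/2, 1/2, 1/2, -1/2⟩ ∈ order (-1) 3) ∧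
            g * a = b * g) ∧
        g * ⟨0, x.1.1, x.1.2.1, x.1.2.2⟩ = ⟨0, y.1.1, y.1.2.1, y.1.2.2⟩ * g)) := by
  have h2 := card_normOne_classes_eq_two_mul_card_unit_classes ht
  rw [← card_specialPoints_eq_card_unit_classes ht] at h2
  rw [← card_specialPointsPlus_eq_card_normaliser_classes_all ht]
  rcases card_specialPoints_eq_four_mul_or_add_two_eq_four_mul ht with h | h
  · left; omega
  · right; omega

/-- **`8 ∣ |L(t)/Γ₆|` IFF `t ∉ ℤ² ∪ 3ℤ² ∪ 6ℤ²`** (`t > 0`) — the three commuting involutions (sign, `ω₂`, `ω₃`) on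
`L(t)/Γ₆` generate a FREE `(ℤ/2ℤ)³` exactly when `Z(t)` avoids the elliptic points; g35's `eight_dvd_card_normOne_classes`
assumed `3 ∤ t`, `t ≡ 3 (mod 4)`. E.g. `|L(t)/Γ₆| = 8` for `t = 10, 13, 19, 21, 22`. [cite: KudlaRapoportYang2006, §3.4 (3.4.11)–(3.4.13) and Remark 3.4.7] [cite: VignerasLNM800, Ch. IV §3 B] [cite: Ogg1983RealPoints, §2 (2)–(4)] -/
theorem eight_dvd_card_normOne_classes_iff {t : ℤ} (ht : 0 < t) :
    8 ∣ Nat.card (Quot (fun x y : {x : ℤ × ℤ × ℤ // x.1 ^ 2 - 3 * x.2.1 ^ 2 - 3 * x.2.2 ^ 2 = t} ↦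
      ∃ u : ℍ[ℚ,((-1 : ℤ) : ℚ),((3 : ℤ) : ℚ)], (u ∈ order (-1) 3 ∨ u - ⟨1/2, 1/2, 1/2, -1/2⟩ ∈ order (-1) 3) ∧
        (u * star u).re = 1 ∧ u * ⟨0, x.1.1, x.1.2.1, x.1.2.2⟩ = ⟨0, y.1.1, y.1.2.1, y.1.2.2⟩ * u)) ↔
    ¬ ∃ m : ℤ, t = m ^ 2 ∨ t = 3 * m ^ 2 ∨ t = 6 * m ^ 2 := by
  have h2 := card_normOne_classes_eq_two_mul_card_unit_classes ht
  rw [← card_specialPoints_eq_card_unit_classes ht] at h2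
  constructor
  · rintro ⟨k, hk⟩ hany
    have key := (card_specialPoints_add_two_eq_four_mul_card_specialPointsPlus_iff ht).2 hany
    omega
  · intro hne
    have key := (card_specialPoints_eq_four_mul_card_specialPointsPlus_iff ht).2 hne
    exact ⟨Nat.card (Quot (fun p q : {τ : ℂ // 0 < τ.im ∧ ∃ x : ℍ[ℚ,((-1 : ℤ) : ℚ),((3 : ℤ) : ℚ)],
        x ∈ order (-1) 3 ∧ x.re = 0 ∧ (x * star x).re = t ∧ moebius (rho (-1) 3 (by norm_num) (castQ (-1) 3 x)) τ = τ} ↦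
      ∃ g : ℍ[ℚ,((-1 : ℤ) : ℚ),((3 : ℤ) : ℚ)], g ≠ 0 ∧
        (∀ a : ℍ[ℚ,((-1 : ℤ) : ℚ),((3 : ℤ) : ℚ)], (a ∈ order (-1) 3 ∨ a - ⟨1/2, 1/2, 1/2, -1/2⟩ ∈ order (-1) 3) →
          ∃ b : ℍ[ℚ,((-1 : ℤ) : ℚ),((3 : ℤ) : ℚ)], (b ∈ order (-1) 3 ∨ b - ⟨1/2, 1/2, 1/2, -1/2⟩ ∈ order (-1) 3) ∧
            g * a = b * g) ∧
        0 < (g * star g).re ∧ moebius (rho (-1) 3 (by norm_num) (castQ (-1) 3 g)) p.1 = q.1)), by omega⟩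

/-- **`|L(t)/Γ₆| ≡ 4 (mod 8)` IFF `t ∈ ℤ² ∪ 3ℤ² ∪ 6ℤ²`** (`t > 0`): `|L(1)/Γ₆| = |L(3)/Γ₆| = |L(6)/Γ₆| = 4`,
`|L(25)/Γ₆| = |L(75)/Γ₆| = 12`, … [cite: KudlaRapoportYang2006, §3.4 (3.4.11)–(3.4.13) and Remark 3.4.7] [cite: VignerasLNM800, Ch. IV §3 B] [cite: Ogg1983RealPoints, §2 (2)–(4)] -/
theorem card_normOne_classes_mod_eight_eq_four_iff {t : ℤ} (ht : 0 < t) :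
    Nat.card (Quot (fun x y : {x : ℤ × ℤ × ℤ // x.1 ^ 2 - 3 * x.2.1 ^ 2 - 3 * x.2.2 ^ 2 = t} ↦
      ∃ u : ℍ[ℚ,((-1 : ℤ) : ℚ),((3 : ℤ) : ℚ)], (u ∈ order (-1) 3 ∨ u - ⟨1/2, 1/2, 1/2, -1/2⟩ ∈ order (-1) 3) ∧
        (u * star u).re = 1 ∧ u * ⟨0, x.1.1, x.1.2.1, x.1.2.2⟩ = ⟨0, y.1.1, y.1.2.1, y.1.2.2⟩ * u)) % 8 = 4 ↔
    ∃ m : ℤ, t = m ^ 2 ∨ t = 3 * m ^ 2 ∨ t = 6 * m ^ 2 := by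
  have h2 := card_normOne_classes_eq_two_mul_card_unit_classes ht
  rw [← card_specialPoints_eq_card_unit_classes ht] at h2
  constructor
  · intro h
    by_contra hne
    have key := (card_specialPoints_eq_four_mul_card_specialPointsPlus_iff ht).2 hne
    omega
  · intro hany
    have key := (card_specialPoints_add_two_eq_four_mul_card_specialPointsPlus_iff ht).2 hany
    omega

end Vectors

/-! ## §4 The double covers `X₆^{(d)} → X₆⁺` on `Z(t)`: `#(Pt(t)/Γ₆^{(d)}) ∈ {2N, 2N − 1}` -/

section AtkinLehner

/-- **`2·#(Pt(t)/Γ₆^{(2)}) + #((Pt(t) ∩ Pt(3))/Γ₆) + #((Pt(t) ∩ Pt(6))/Γ₆) = 4·#(Pt(t)/Γ₆⁺)`, EVERY `t > 0`** —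
Burnside for `W` minus Burnside for `⟨ω_2⟩`: the double cover `X₆^{(2)} → X₆⁺` restricted to `Z(t)` is ramified exactly
at the images of the fixed points of the two OTHER involutions. [cite: Ogg1983RealPoints, §2 (2)–(4)] [cite: BayerTravesa2007, §2] [cite: KudlaRapoportYang2006, §3.4 Remark 3.4.7] -/
theorem two_mul_card_atkinLehnerQuotientTwo_add_eq_four_mul_card_specialPointsPlus {t : ℤ} (ht : 0 < t) :
    2 * Nat.card (Quot (fun p q : {τ : ℂ // 0 < τ.im ∧ ∃ x : ℍ[ℚ,((-1 : ℤ) : ℚ),((3 : ℤ) : ℚ)],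
        x ∈ order (-1) 3 ∧ x.re = 0 ∧ (x * star x).re = t ∧ moebius (rho (-1) 3 (by norm_num) (castQ (-1) 3 x)) τ = τ} ↦
      ∃ g : ℍ[ℚ,((-1 : ℤ) : ℚ),((3 : ℤ) : ℚ)], g ≠ 0 ∧
        (∀ a : ℍ[ℚ,((-1 : ℤ) : ℚ),((3 : ℤ) : ℚ)], (a ∈ order (-1) 3 ∨ a - ⟨1/2, 1/2, 1/2, -1/2⟩ ∈ order (-1) 3) →
          ∃ b : ℍ[ℚ,((-1 : ℤ) : ℚ),((3 : ℤ) : ℚ)], (b ∈ order (-1) 3 ∨ b - ⟨1/2, 1/2, 1/2, -1/2⟩ ∈ order (-1) 3) ∧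
            g * a = b * g) ∧
        0 < (g * star g).re ∧ (∃ s : ℚ, (g * star g).re = s ^ 2 ∨ (g * star g).re = 2 * s ^ 2) ∧
        moebius (rho (-1) 3 (by norm_num) (castQ (-1) 3 g)) p.1 = q.1)) +
    Nat.card (Quot (fun p q : {τ : ℂ // 0 < τ.im ∧ (∃ x : ℍ[ℚ,((-1 : ℤ) : ℚ),((3 : ℤ) : ℚ)],
        x ∈ order (-1) 3 ∧ x.re = 0 ∧ (x * star x).re = t ∧ moebius (rho (-1) 3 (by norm_num) (castQ (-1) 3 x)) τ = τ) ∧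
        (∃ y : ℍ[ℚ,((-1 : ℤ) : ℚ),((3 : ℤ) : ℚ)], y ∈ order (-1) 3 ∧ y.re = 0 ∧ (y * star y).re = ((3 : ℤ) : ℚ) ∧
          moebius (rho (-1) 3 (by norm_num) (castQ (-1) 3 y)) τ = τ)} ↦
      ∃ v : ℍ[ℚ,((-1 : ℤ) : ℚ),((3 : ℤ) : ℚ)], (v ∈ order (-1) 3 ∨ v - ⟨1/2, 1/2, 1/2, -1/2⟩ ∈ order (-1) 3) ∧
        v * star v = 1 ∧ moebius (rho (-1) 3 (by norm_num) (castQ (-1) 3 v)) p.1 = q.1)) +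
    Nat.card (Quot (fun p q : {τ : ℂ // 0 < τ.im ∧ (∃ x : ℍ[ℚ,((-1 : ℤ) : ℚ),((3 : ℤ) : ℚ)],
        x ∈ order (-1) 3 ∧ x.re = 0 ∧ (x * star x).re = t ∧ moebius (rho (-1) 3 (by norm_num) (castQ (-1) 3 x)) τ = τ) ∧
        (∃ y : ℍ[ℚ,((-1 : ℤ) : ℚ),((3 : ℤ) : ℚ)], y ∈ order (-1) 3 ∧ y.re = 0 ∧ (y * star y).re = ((6 : ℤ) : ℚ) ∧
          moebius (rho (-1) 3 (by norm_num) (castQ (-1) 3 y)) τ = τ)} ↦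
      ∃ v : ℍ[ℚ,((-1 : ℤ) : ℚ),((3 : ℤ) : ℚ)], (v ∈ order (-1) 3 ∨ v - ⟨1/2, 1/2, 1/2, -1/2⟩ ∈ order (-1) 3) ∧
        v * star v = 1 ∧ moebius (rho (-1) 3 (by norm_num) (castQ (-1) 3 v)) p.1 = q.1)) =
    4 * Nat.card (Quot (fun p q : {τ : ℂ // 0 < τ.im ∧ ∃ x : ℍ[ℚ,((-1 : ℤ) : ℚ),((3 : ℤ) : ℚ)],
        x ∈ order (-1) 3 ∧ x.re = 0 ∧ (x * star x).re = t ∧ moebius (rho (-1) 3 (by norm_num) (castQ (-1) 3 x)) τ = τ} ↦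
      ∃ g : ℍ[ℚ,((-1 : ℤ) : ℚ),((3 : ℤ) : ℚ)], g ≠ 0 ∧
        (∀ a : ℍ[ℚ,((-1 : ℤ) : ℚ),((3 : ℤ) : ℚ)], (a ∈ order (-1) 3 ∨ a - ⟨1/2, 1/2, 1/2, -1/2⟩ ∈ order (-1) 3) →
          ∃ b : ℍ[ℚ,((-1 : ℤ) : ℚ),((3 : ℤ) : ℚ)], (b ∈ order (-1) 3 ∨ b - ⟨1/2, 1/2, 1/2, -1/2⟩ ∈ order (-1) 3) ∧
            g * a = b * g) ∧
        0 < (g * star g).re ∧ moebius (rho (-1) 3 (by norm_num) (castQ (-1) 3 g)) p.1 = q.1)) := by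
  have hB := card_specialPoints_add_card_inter_eq_four_mul_card_specialPointsPlus ht
  have hD := card_specialPoints_add_card_inter_eq_two_mul_card_atkinLehnerQuotientTwo ht
  omega

/-- **`#(Pt(t)/Γ₆^{(2)}) = 2·#(Pt(t)/Γ₆⁺)` for `t ∉ 3ℤ² ∪ 6ℤ²`** (`t > 0`): `Z(t)` on `X₆^{(2)}` is an
unramified double cover of `Z(t)` on `X₆⁺`. [cite: Ogg1983RealPoints, §2 (2)–(4)] [cite: BayerTravesa2007, §2] [cite: KudlaRapoportYang2006, §3.4 Remark 3.4.7 and (3.4.6)] -/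
theorem card_atkinLehnerQuotientTwo_eq_two_mul_card_specialPointsPlus_of_not_of_not {t : ℤ} (ht : 0 < t)
    (h₁ : ¬ ∃ m : ℤ, t = 3 * m ^ 2) (h₂ : ¬ ∃ m : ℤ, t = 6 * m ^ 2) :
    Nat.card (Quot (fun p q : {τ : ℂ // 0 < τ.im ∧ ∃ x : ℍ[ℚ,((-1 : ℤ) : ℚ),((3 : ℤ) : ℚ)],
        x ∈ order (-1) 3 ∧ x.re = 0 ∧ (x * star x).re = t ∧ moebius (rho (-1) 3 (by norm_num) (castQ (-1) 3 x)) τ = τ} ↦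
      ∃ g : ℍ[ℚ,((-1 : ℤ) : ℚ),((3 : ℤ) : ℚ)], g ≠ 0 ∧
        (∀ a : ℍ[ℚ,((-1 : ℤ) : ℚ),((3 : ℤ) : ℚ)], (a ∈ order (-1) 3 ∨ a - ⟨1/2, 1/2, 1/2, -1/2⟩ ∈ order (-1) 3) →
          ∃ b : ℍ[ℚ,((-1 : ℤ) : ℚ),((3 : ℤ) : ℚ)], (b ∈ order (-1) 3 ∨ b - ⟨1/2, 1/2, 1/2, -1/2⟩ ∈ order (-1) 3) ∧
            g * a = b * g) ∧
        0 < (g * star g).re ∧ (∃ s : ℚ, (g * star g).re = s ^ 2 ∨ (g * star g).re = 2 * s ^ 2) ∧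
        moebius (rho (-1) 3 (by norm_num) (castQ (-1) 3 g)) p.1 = q.1)) =
    2 * Nat.card (Quot (fun p q : {τ : ℂ // 0 < τ.im ∧ ∃ x : ℍ[ℚ,((-1 : ℤ) : ℚ),((3 : ℤ) : ℚ)],
        x ∈ order (-1) 3 ∧ x.re = 0 ∧ (x * star x).re = t ∧ moebius (rho (-1) 3 (by norm_num) (castQ (-1) 3 x)) τ = τ} ↦
      ∃ g : ℍ[ℚ,((-1 : ℤ) : ℚ),((3 : ℤ) : ℚ)], g ≠ 0 ∧
        (∀ a : ℍ[ℚ,((-1 : ℤ) : ℚ),((3 : ℤ) : ℚ)], (a ∈ order (-1) 3 ∨ a - ⟨1/2, 1/2, 1/2, -1/2⟩ ∈ order (-1) 3) →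
          ∃ b : ℍ[ℚ,((-1 : ℤ) : ℚ),((3 : ℤ) : ℚ)], (b ∈ order (-1) 3 ∨ b - ⟨1/2, 1/2, 1/2, -1/2⟩ ∈ order (-1) 3) ∧
            g * a = b * g) ∧
        0 < (g * star g).re ∧ moebius (rho (-1) 3 (by norm_num) (castQ (-1) 3 g)) p.1 = q.1)) := by
  have key := two_mul_card_atkinLehnerQuotientTwo_add_eq_four_mul_card_specialPointsPlus ht
  rw [card_specialPoints_inter_eq_zero (by norm_num) (not_rat_sq_three₁₆ h₁),
    card_specialPoints_inter_eq_zero (by norm_num) (not_rat_sq_six₁₆ h₂)] at key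
  omega

/-- **`#(Pt(t)/Γ₆^{(2)}) + 1 = 2·#(Pt(t)/Γ₆⁺)` for `t ∈ 3ℤ²`** (`t > 0`): the double cover `X₆^{(2)} → X₆⁺` on `Z(t)`
is ramified at the single image of the two `Z(3)`-points. [cite: Ogg1983RealPoints, §2 p. 284 and (3)–(4)] [cite: BayerTravesa2007, §1 Thm. 1.1 and §2] [cite: KudlaRapoportYang2006, §3.4 Remark 3.4.7 and (3.4.6)] -/
theorem card_atkinLehnerQuotientTwo_add_one_eq_two_mul_card_specialPointsPlus_of_three_mul_sq {t : ℤ} (ht : 0 < t)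
    {m : ℤ} (hm : t = 3 * m ^ 2) :
    Nat.card (Quot (fun p q : {τ : ℂ // 0 < τ.im ∧ ∃ x : ℍ[ℚ,((-1 : ℤ) : ℚ),((3 : ℤ) : ℚ)],
        x ∈ order (-1) 3 ∧ x.re = 0 ∧ (x * star x).re = t ∧ moebius (rho (-1) 3 (by norm_num) (castQ (-1) 3 x)) τ = τ} ↦
      ∃ g : ℍ[ℚ,((-1 : ℤ) : ℚ),((3 : ℤ) : ℚ)], g ≠ 0 ∧
        (∀ a : ℍ[ℚ,((-1 : ℤ) : ℚ),((3 : ℤ) : ℚ)], (a ∈ order (-1) 3 ∨ a - ⟨1/2, 1/2, 1/2, -1/2⟩ ∈ order (-1) 3) →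
          ∃ b : ℍ[ℚ,((-1 : ℤ) : ℚ),((3 : ℤ) : ℚ)], (b ∈ order (-1) 3 ∨ b - ⟨1/2, 1/2, 1/2, -1/2⟩ ∈ order (-1) 3) ∧
            g * a = b * g) ∧
        0 < (g * star g).re ∧ (∃ s : ℚ, (g * star g).re = s ^ 2 ∨ (g * star g).re = 2 * s ^ 2) ∧
        moebius (rho (-1) 3 (by norm_num) (castQ (-1) 3 g)) p.1 = q.1)) + 1 =
    2 * Nat.card (Quot (fun p q : {τ : ℂ // 0 < τ.im ∧ ∃ x : ℍ[ℚ,((-1 : ℤ) : ℚ),((3 : ℤ) : ℚ)],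
        x ∈ order (-1) 3 ∧ x.re = 0 ∧ (x * star x).re = t ∧ moebius (rho (-1) 3 (by norm_num) (castQ (-1) 3 x)) τ = τ} ↦
      ∃ g : ℍ[ℚ,((-1 : ℤ) : ℚ),((3 : ℤ) : ℚ)], g ≠ 0 ∧
        (∀ a : ℍ[ℚ,((-1 : ℤ) : ℚ),((3 : ℤ) : ℚ)], (a ∈ order (-1) 3 ∨ a - ⟨1/2, 1/2, 1/2, -1/2⟩ ∈ order (-1) 3) →
          ∃ b : ℍ[ℚ,((-1 : ℤ) : ℚ),((3 : ℤ) : ℚ)], (b ∈ order (-1) 3 ∨ b - ⟨1/2, 1/2, 1/2, -1/2⟩ ∈ order (-1) 3) ∧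
            g * a = b * g) ∧
        0 < (g * star g).re ∧ moebius (rho (-1) 3 (by norm_num) (castQ (-1) 3 g)) p.1 = q.1)) := by
  have key := two_mul_card_atkinLehnerQuotientTwo_add_eq_four_mul_card_specialPointsPlus ht
  have hm0 : m ≠ 0 := by rintro rfl; rw [hm] at ht; norm_num at ht
  rw [card_specialPoints_inter_eq_card_of_sq_mul (t := t) (t₀ := 3) hm0 (by rw [hm, mul_comm]), card_specialPoints_table.2.1,
    card_specialPoints_inter_eq_zero (by norm_num) (not_rat_sq_six₁₆ (not_six_mul_sq_of_three_mul_sq₁₆ ht.ne' hm))] at key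
  omega

/-- **`#(Pt(t)/Γ₆^{(2)}) + 1 = 2·#(Pt(t)/Γ₆⁺)` for `t ∈ 6ℤ²`** (`t > 0`): the double cover `X₆^{(2)} → X₆⁺` on `Z(t)`
is ramified at the single image of the two `Z(6)`-points. [cite: Ogg1983RealPoints, §2 p. 284 and (3)–(4)] [cite: BayerTravesa2007, §1 Thm. 1.1 and §2] [cite: KudlaRapoportYang2006, §3.4 Remark 3.4.7 and (3.4.6)] -/
theorem card_atkinLehnerQuotientTwo_add_one_eq_two_mul_card_specialPointsPlus_of_six_mul_sq {t : ℤ} (ht : 0 < t)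
    {m : ℤ} (hm : t = 6 * m ^ 2) :
    Nat.card (Quot (fun p q : {τ : ℂ // 0 < τ.im ∧ ∃ x : ℍ[ℚ,((-1 : ℤ) : ℚ),((3 : ℤ) : ℚ)],
        x ∈ order (-1) 3 ∧ x.re = 0 ∧ (x * star x).re = t ∧ moebius (rho (-1) 3 (by norm_num) (castQ (-1) 3 x)) τ = τ} ↦
      ∃ g : ℍ[ℚ,((-1 : ℤ) : ℚ),((3 : ℤ) : ℚ)], g ≠ 0 ∧
        (∀ a : ℍ[ℚ,((-1 : ℤ) : ℚ),((3 : ℤ) : ℚ)], (a ∈ order (-1) 3 ∨ a - ⟨1/2, 1/2, 1/2, -1/2⟩ ∈ order (-1) 3) →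
          ∃ b : ℍ[ℚ,((-1 : ℤ) : ℚ),((3 : ℤ) : ℚ)], (b ∈ order (-1) 3 ∨ b - ⟨1/2, 1/2, 1/2, -1/2⟩ ∈ order (-1) 3) ∧
            g * a = b * g) ∧
        0 < (g * star g).re ∧ (∃ s : ℚ, (g * star g).re = s ^ 2 ∨ (g * star g).re = 2 * s ^ 2) ∧
        moebius (rho (-1) 3 (by norm_num) (castQ (-1) 3 g)) p.1 = q.1)) + 1 =
    2 * Nat.card (Quot (fun p q : {τ : ℂ // 0 < τ.im ∧ ∃ x : ℍ[ℚ,((-1 : ℤ) : ℚ),((3 : ℤ) : ℚ)],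
        x ∈ order (-1) 3 ∧ x.re = 0 ∧ (x * star x).re = t ∧ moebius (rho (-1) 3 (by norm_num) (castQ (-1) 3 x)) τ = τ} ↦
      ∃ g : ℍ[ℚ,((-1 : ℤ) : ℚ),((3 : ℤ) : ℚ)], g ≠ 0 ∧
        (∀ a : ℍ[ℚ,((-1 : ℤ) : ℚ),((3 : ℤ) : ℚ)], (a ∈ order (-1) 3 ∨ a - ⟨1/2, 1/2, 1/2, -1/2⟩ ∈ order (-1) 3) →
          ∃ b : ℍ[ℚ,((-1 : ℤ) : ℚ),((3 : ℤ) : ℚ)], (b ∈ order (-1) 3 ∨ b - ⟨1/2, 1/2, 1/2, -1/2⟩ ∈ order (-1) 3) ∧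
            g * a = b * g) ∧
        0 < (g * star g).re ∧ moebius (rho (-1) 3 (by norm_num) (castQ (-1) 3 g)) p.1 = q.1)) := by
  have key := two_mul_card_atkinLehnerQuotientTwo_add_eq_four_mul_card_specialPointsPlus ht
  have hm0 : m ≠ 0 := by rintro rfl; rw [hm] at ht; norm_num at ht
  rw [card_specialPoints_inter_eq_card_of_sq_mul (t := t) (t₀ := 6) hm0 (by rw [hm, mul_comm]), card_specialPoints_table.2.2.1,
    card_specialPoints_inter_eq_zero (by norm_num) (not_rat_sq_three₁₆ (not_three_mul_sq_of_six_mul_sq₁₆ ht.ne' hm))] at key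
  omega

/-- **`#(Pt(t)/Γ₆^{(2)})` IS ODD IFF `t ∈ 3ℤ² ∪ 6ℤ²`** (`t > 0`): `2N − 1` against `2N`. [cite: Ogg1983RealPoints, §2 (2)–(4)] [cite: BayerTravesa2007, §2 and §7 Table 9] [cite: KudlaRapoportYang2006, §3.4 Remark 3.4.7] -/
theorem odd_card_atkinLehnerQuotientTwo_iff {t : ℤ} (ht : 0 < t) :
    Odd (Nat.card (Quot (fun p q : {τ : ℂ // 0 < τ.im ∧ ∃ x : ℍ[ℚ,((-1 : ℤ) : ℚ),((3 : ℤ) : ℚ)],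
        x ∈ order (-1) 3 ∧ x.re = 0 ∧ (x * star x).re = t ∧ moebius (rho (-1) 3 (by norm_num) (castQ (-1) 3 x)) τ = τ} ↦
      ∃ g : ℍ[ℚ,((-1 : ℤ) : ℚ),((3 : ℤ) : ℚ)], g ≠ 0 ∧
        (∀ a : ℍ[ℚ,((-1 : ℤ) : ℚ),((3 : ℤ) : ℚ)], (a ∈ order (-1) 3 ∨ a - ⟨1/2, 1/2, 1/2, -1/2⟩ ∈ order (-1) 3) →
          ∃ b : ℍ[ℚ,((-1 : ℤ) : ℚ),((3 : ℤ) : ℚ)], (b ∈ order (-1) 3 ∨ b - ⟨1/2, 1/2, 1/2, -1/2⟩ ∈ order (-1) 3) ∧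
            g * a = b * g) ∧
        0 < (g * star g).re ∧ (∃ s : ℚ, (g * star g).re = s ^ 2 ∨ (g * star g).re = 2 * s ^ 2) ∧
        moebius (rho (-1) 3 (by norm_num) (castQ (-1) 3 g)) p.1 = q.1))) ↔
    (∃ m : ℤ, t = 3 * m ^ 2) ∨ (∃ m : ℤ, t = 6 * m ^ 2) := by
  rw [Nat.odd_iff]
  constructor
  · intro h
    by_contra hne
    have h₁ : ¬ ∃ m : ℤ, t = 3 * m ^ 2 := fun h' ↦ hne (Or.inl h')
    have h₂ : ¬ ∃ m : ℤ, t = 6 * m ^ 2 := fun h' ↦ hne (Or.inr h')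
    have key := card_atkinLehnerQuotientTwo_eq_two_mul_card_specialPointsPlus_of_not_of_not ht h₁ h₂
    omega
  · rintro (⟨m, hm⟩ | ⟨m, hm⟩)
    · have key := card_atkinLehnerQuotientTwo_add_one_eq_two_mul_card_specialPointsPlus_of_three_mul_sq ht hm
      omega
    · have key := card_atkinLehnerQuotientTwo_add_one_eq_two_mul_card_specialPointsPlus_of_six_mul_sq ht hm
      omega

/-- **`2·#(Pt(t)/Γ₆^{(3)}) + #((Pt(t) ∩ Pt(1))/Γ₆) + #((Pt(t) ∩ Pt(6))/Γ₆) = 4·#(Pt(t)/Γ₆⁺)`, EVERY `t > 0`** —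
Burnside for `W` minus Burnside for `⟨ω_3⟩`: the double cover `X₆^{(3)} → X₆⁺` restricted to `Z(t)` is ramified exactly
at the images of the fixed points of the two OTHER involutions. [cite: Ogg1983RealPoints, §2 (2)–(4)] [cite: BayerTravesa2007, §2] [cite: KudlaRapoportYang2006, §3.4 Remark 3.4.7] -/
theorem two_mul_card_atkinLehnerQuotientThree_add_eq_four_mul_card_specialPointsPlus {t : ℤ} (ht : 0 < t) :
    2 * Nat.card (Quot (fun p q : {τ : ℂ // 0 < τ.im ∧ ∃ x : ℍ[ℚ,((-1 : ℤ) : ℚ),((3 : ℤ) : ℚ)],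
        x ∈ order (-1) 3 ∧ x.re = 0 ∧ (x * star x).re = t ∧ moebius (rho (-1) 3 (by norm_num) (castQ (-1) 3 x)) τ = τ} ↦
      ∃ g : ℍ[ℚ,((-1 : ℤ) : ℚ),((3 : ℤ) : ℚ)], g ≠ 0 ∧
        (∀ a : ℍ[ℚ,((-1 : ℤ) : ℚ),((3 : ℤ) : ℚ)], (a ∈ order (-1) 3 ∨ a - ⟨1/2, 1/2, 1/2, -1/2⟩ ∈ order (-1) 3) →
          ∃ b : ℍ[ℚ,((-1 : ℤ) : ℚ),((3 : ℤ) : ℚ)], (b ∈ order (-1) 3 ∨ b - ⟨1/2, 1/2, 1/2, -1/2⟩ ∈ order (-1) 3) ∧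
            g * a = b * g) ∧
        0 < (g * star g).re ∧ (∃ s : ℚ, (g * star g).re = s ^ 2 ∨ (g * star g).re = 3 * s ^ 2) ∧
        moebius (rho (-1) 3 (by norm_num) (castQ (-1) 3 g)) p.1 = q.1)) +
    Nat.card (Quot (fun p q : {τ : ℂ // 0 < τ.im ∧ (∃ x : ℍ[ℚ,((-1 : ℤ) : ℚ),((3 : ℤ) : ℚ)],
        x ∈ order (-1) 3 ∧ x.re = 0 ∧ (x * star x).re = t ∧ moebius (rho (-1) 3 (by norm_num) (castQ (-1) 3 x)) τ = τ) ∧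
        (∃ y : ℍ[ℚ,((-1 : ℤ) : ℚ),((3 : ℤ) : ℚ)], y ∈ order (-1) 3 ∧ y.re = 0 ∧ (y * star y).re = ((1 : ℤ) : ℚ) ∧
          moebius (rho (-1) 3 (by norm_num) (castQ (-1) 3 y)) τ = τ)} ↦
      ∃ v : ℍ[ℚ,((-1 : ℤ) : ℚ),((3 : ℤ) : ℚ)], (v ∈ order (-1) 3 ∨ v - ⟨1/2, 1/2, 1/2, -1/2⟩ ∈ order (-1) 3) ∧
        v * star v = 1 ∧ moebius (rho (-1) 3 (by norm_num) (castQ (-1) 3 v)) p.1 = q.1)) +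
    Nat.card (Quot (fun p q : {τ : ℂ // 0 < τ.im ∧ (∃ x : ℍ[ℚ,((-1 : ℤ) : ℚ),((3 : ℤ) : ℚ)],
        x ∈ order (-1) 3 ∧ x.re = 0 ∧ (x * star x).re = t ∧ moebius (rho (-1) 3 (by norm_num) (castQ (-1) 3 x)) τ = τ) ∧
        (∃ y : ℍ[ℚ,((-1 : ℤ) : ℚ),((3 : ℤ) : ℚ)], y ∈ order (-1) 3 ∧ y.re = 0 ∧ (y * star y).re = ((6 : ℤ) : ℚ) ∧
          moebius (rho (-1) 3 (by norm_num) (castQ (-1) 3 y)) τ = τ)} ↦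
      ∃ v : ℍ[ℚ,((-1 : ℤ) : ℚ),((3 : ℤ) : ℚ)], (v ∈ order (-1) 3 ∨ v - ⟨1/2, 1/2, 1/2, -1/2⟩ ∈ order (-1) 3) ∧
        v * star v = 1 ∧ moebius (rho (-1) 3 (by norm_num) (castQ (-1) 3 v)) p.1 = q.1)) =
    4 * Nat.card (Quot (fun p q : {τ : ℂ // 0 < τ.im ∧ ∃ x : ℍ[ℚ,((-1 : ℤ) : ℚ),((3 : ℤ) : ℚ)],
        x ∈ order (-1) 3 ∧ x.re = 0 ∧ (x * star x).re = t ∧ moebius (rho (-1) 3 (by norm_num) (castQ (-1) 3 x)) τ = τ} ↦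
      ∃ g : ℍ[ℚ,((-1 : ℤ) : ℚ),((3 : ℤ) : ℚ)], g ≠ 0 ∧
        (∀ a : ℍ[ℚ,((-1 : ℤ) : ℚ),((3 : ℤ) : ℚ)], (a ∈ order (-1) 3 ∨ a - ⟨1/2, 1/2, 1/2, -1/2⟩ ∈ order (-1) 3) →
          ∃ b : ℍ[ℚ,((-1 : ℤ) : ℚ),((3 : ℤ) : ℚ)], (b ∈ order (-1) 3 ∨ b - ⟨1/2, 1/2, 1/2, -1/2⟩ ∈ order (-1) 3) ∧
            g * a = b * g) ∧
        0 < (g * star g).re ∧ moebius (rho (-1) 3 (by norm_num) (castQ (-1) 3 g)) p.1 = q.1)) := by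
  have hB := card_specialPoints_add_card_inter_eq_four_mul_card_specialPointsPlus ht
  have hD := card_specialPoints_add_card_inter_eq_two_mul_card_atkinLehnerQuotientThree ht
  omega

/-- **`#(Pt(t)/Γ₆^{(3)}) = 2·#(Pt(t)/Γ₆⁺)` for `t ∉ ℤ² ∪ 6ℤ²`** (`t > 0`): `Z(t)` on `X₆^{(3)}` is an
unramified double cover of `Z(t)` on `X₆⁺`. [cite: Ogg1983RealPoints, §2 (2)–(4)] [cite: BayerTravesa2007, §2] [cite: KudlaRapoportYang2006, §3.4 Remark 3.4.7 and (3.4.6)] -/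
theorem card_atkinLehnerQuotientThree_eq_two_mul_card_specialPointsPlus_of_not_of_not {t : ℤ} (ht : 0 < t)
    (h₁ : ¬ ∃ m : ℤ, t = m ^ 2) (h₂ : ¬ ∃ m : ℤ, t = 6 * m ^ 2) :
    Nat.card (Quot (fun p q : {τ : ℂ // 0 < τ.im ∧ ∃ x : ℍ[ℚ,((-1 : ℤ) : ℚ),((3 : ℤ) : ℚ)],
        x ∈ order (-1) 3 ∧ x.re = 0 ∧ (x * star x).re = t ∧ moebius (rho (-1) 3 (by norm_num) (castQ (-1) 3 x)) τ = τ} ↦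
      ∃ g : ℍ[ℚ,((-1 : ℤ) : ℚ),((3 : ℤ) : ℚ)], g ≠ 0 ∧
        (∀ a : ℍ[ℚ,((-1 : ℤ) : ℚ),((3 : ℤ) : ℚ)], (a ∈ order (-1) 3 ∨ a - ⟨1/2, 1/2, 1/2, -1/2⟩ ∈ order (-1) 3) →
          ∃ b : ℍ[ℚ,((-1 : ℤ) : ℚ),((3 : ℤ) : ℚ)], (b ∈ order (-1) 3 ∨ b - ⟨1/2, 1/2, 1/2, -1/2⟩ ∈ order (-1) 3) ∧
            g * a = b * g) ∧
        0 < (g * star g).re ∧ (∃ s : ℚ, (g * star g).re = s ^ 2 ∨ (g * star g).re = 3 * s ^ 2) ∧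
        moebius (rho (-1) 3 (by norm_num) (castQ (-1) 3 g)) p.1 = q.1)) =
    2 * Nat.card (Quot (fun p q : {τ : ℂ // 0 < τ.im ∧ ∃ x : ℍ[ℚ,((-1 : ℤ) : ℚ),((3 : ℤ) : ℚ)],
        x ∈ order (-1) 3 ∧ x.re = 0 ∧ (x * star x).re = t ∧ moebius (rho (-1) 3 (by norm_num) (castQ (-1) 3 x)) τ = τ} ↦
      ∃ g : ℍ[ℚ,((-1 : ℤ) : ℚ),((3 : ℤ) : ℚ)], g ≠ 0 ∧
        (∀ a : ℍ[ℚ,((-1 : ℤ) : ℚ),((3 : ℤ) : ℚ)], (a ∈ order (-1) 3 ∨ a - ⟨1/2, 1/2, 1/2, -1/2⟩ ∈ order (-1) 3) →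
          ∃ b : ℍ[ℚ,((-1 : ℤ) : ℚ),((3 : ℤ) : ℚ)], (b ∈ order (-1) 3 ∨ b - ⟨1/2, 1/2, 1/2, -1/2⟩ ∈ order (-1) 3) ∧
            g * a = b * g) ∧
        0 < (g * star g).re ∧ moebius (rho (-1) 3 (by norm_num) (castQ (-1) 3 g)) p.1 = q.1)) := by
  have key := two_mul_card_atkinLehnerQuotientThree_add_eq_four_mul_card_specialPointsPlus ht
  rw [card_specialPoints_inter_eq_zero (by norm_num) (not_rat_sq_one₁₆ h₁),
    card_specialPoints_inter_eq_zero (by norm_num) (not_rat_sq_six₁₆ h₂)] at key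
  omega

/-- **`#(Pt(t)/Γ₆^{(3)}) + 1 = 2·#(Pt(t)/Γ₆⁺)` for `t ∈ ℤ²`** (`t > 0`): the double cover `X₆^{(3)} → X₆⁺` on `Z(t)`
is ramified at the single image of the two `Z(1)`-points. [cite: Ogg1983RealPoints, §2 p. 284 and (3)–(4)] [cite: BayerTravesa2007, §1 Thm. 1.1 and §2] [cite: KudlaRapoportYang2006, §3.4 Remark 3.4.7 and (3.4.6)] -/
theorem card_atkinLehnerQuotientThree_add_one_eq_two_mul_card_specialPointsPlus_of_sq {t : ℤ} (ht : 0 < t)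
    {m : ℤ} (hm : t = m ^ 2) :
    Nat.card (Quot (fun p q : {τ : ℂ // 0 < τ.im ∧ ∃ x : ℍ[ℚ,((-1 : ℤ) : ℚ),((3 : ℤ) : ℚ)],
        x ∈ order (-1) 3 ∧ x.re = 0 ∧ (x * star x).re = t ∧ moebius (rho (-1) 3 (by norm_num) (castQ (-1) 3 x)) τ = τ} ↦
      ∃ g : ℍ[ℚ,((-1 : ℤ) : ℚ),((3 : ℤ) : ℚ)], g ≠ 0 ∧
        (∀ a : ℍ[ℚ,((-1 : ℤ) : ℚ),((3 : ℤ) : ℚ)], (a ∈ order (-1) 3 ∨ a - ⟨1/2, 1/2, 1/2, -1/2⟩ ∈ order (-1) 3) →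
          ∃ b : ℍ[ℚ,((-1 : ℤ) : ℚ),((3 : ℤ) : ℚ)], (b ∈ order (-1) 3 ∨ b - ⟨1/2, 1/2, 1/2, -1/2⟩ ∈ order (-1) 3) ∧
            g * a = b * g) ∧
        0 < (g * star g).re ∧ (∃ s : ℚ, (g * star g).re = s ^ 2 ∨ (g * star g).re = 3 * s ^ 2) ∧
        moebius (rho (-1) 3 (by norm_num) (castQ (-1) 3 g)) p.1 = q.1)) + 1 =
    2 * Nat.card (Quot (fun p q : {τ : ℂ // 0 < τ.im ∧ ∃ x : ℍ[ℚ,((-1 : ℤ) : ℚ),((3 : ℤ) : ℚ)],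
        x ∈ order (-1) 3 ∧ x.re = 0 ∧ (x * star x).re = t ∧ moebius (rho (-1) 3 (by norm_num) (castQ (-1) 3 x)) τ = τ} ↦
      ∃ g : ℍ[ℚ,((-1 : ℤ) : ℚ),((3 : ℤ) : ℚ)], g ≠ 0 ∧
        (∀ a : ℍ[ℚ,((-1 : ℤ) : ℚ),((3 : ℤ) : ℚ)], (a ∈ order (-1) 3 ∨ a - ⟨1/2, 1/2, 1/2, -1/2⟩ ∈ order (-1) 3) →
          ∃ b : ℍ[ℚ,((-1 : ℤ) : ℚ),((3 : ℤ) : ℚ)], (b ∈ order (-1) 3 ∨ b - ⟨1/2, 1/2, 1/2, -1/2⟩ ∈ order (-1) 3) ∧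
            g * a = b * g) ∧
        0 < (g * star g).re ∧ moebius (rho (-1) 3 (by norm_num) (castQ (-1) 3 g)) p.1 = q.1)) := by
  have key := two_mul_card_atkinLehnerQuotientThree_add_eq_four_mul_card_specialPointsPlus ht
  have hm0 : m ≠ 0 := by rintro rfl; rw [hm] at ht; norm_num at ht
  rw [card_specialPoints_inter_eq_card_of_sq_mul (t := t) (t₀ := 1) hm0 (by rw [hm, mul_one]), card_specialPoints_table.1,
    card_specialPoints_inter_eq_zero (by norm_num) (not_rat_sq_six₁₆ (not_six_mul_sq_of_sq₁₆ ht.ne' hm))] at key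
  omega

/-- **`#(Pt(t)/Γ₆^{(3)}) + 1 = 2·#(Pt(t)/Γ₆⁺)` for `t ∈ 6ℤ²`** (`t > 0`): the double cover `X₆^{(3)} → X₆⁺` on `Z(t)`
is ramified at the single image of the two `Z(6)`-points. [cite: Ogg1983RealPoints, §2 p. 284 and (3)–(4)] [cite: BayerTravesa2007, §1 Thm. 1.1 and §2] [cite: KudlaRapoportYang2006, §3.4 Remark 3.4.7 and (3.4.6)] -/
theorem card_atkinLehnerQuotientThree_add_one_eq_two_mul_card_specialPointsPlus_of_six_mul_sq {t : ℤ} (ht : 0 < t)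
    {m : ℤ} (hm : t = 6 * m ^ 2) :
    Nat.card (Quot (fun p q : {τ : ℂ // 0 < τ.im ∧ ∃ x : ℍ[ℚ,((-1 : ℤ) : ℚ),((3 : ℤ) : ℚ)],
        x ∈ order (-1) 3 ∧ x.re = 0 ∧ (x * star x).re = t ∧ moebius (rho (-1) 3 (by norm_num) (castQ (-1) 3 x)) τ = τ} ↦
      ∃ g : ℍ[ℚ,((-1 : ℤ) : ℚ),((3 : ℤ) : ℚ)], g ≠ 0 ∧
        (∀ a : ℍ[ℚ,((-1 : ℤ) : ℚ),((3 : ℤ) : ℚ)], (a ∈ order (-1) 3 ∨ a - ⟨1/2, 1/2, 1/2, -1/2⟩ ∈ order (-1) 3) →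
          ∃ b : ℍ[ℚ,((-1 : ℤ) : ℚ),((3 : ℤ) : ℚ)], (b ∈ order (-1) 3 ∨ b - ⟨1/2, 1/2, 1/2, -1/2⟩ ∈ order (-1) 3) ∧
            g * a = b * g) ∧
        0 < (g * star g).re ∧ (∃ s : ℚ, (g * star g).re = s ^ 2 ∨ (g * star g).re = 3 * s ^ 2) ∧
        moebius (rho (-1) 3 (by norm_num) (castQ (-1) 3 g)) p.1 = q.1)) + 1 =
    2 * Nat.card (Quot (fun p q : {τ : ℂ // 0 < τ.im ∧ ∃ x : ℍ[ℚ,((-1 : ℤ) : ℚ),((3 : ℤ) : ℚ)],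
        x ∈ order (-1) 3 ∧ x.re = 0 ∧ (x * star x).re = t ∧ moebius (rho (-1) 3 (by norm_num) (castQ (-1) 3 x)) τ = τ} ↦
      ∃ g : ℍ[ℚ,((-1 : ℤ) : ℚ),((3 : ℤ) : ℚ)], g ≠ 0 ∧
        (∀ a : ℍ[ℚ,((-1 : ℤ) : ℚ),((3 : ℤ) : ℚ)], (a ∈ order (-1) 3 ∨ a - ⟨1/2, 1/2, 1/2, -1/2⟩ ∈ order (-1) 3) →
          ∃ b : ℍ[ℚ,((-1 : ℤ) : ℚ),((3 : ℤ) : ℚ)], (b ∈ order (-1) 3 ∨ b - ⟨1/2, 1/2, 1/2, -1/2⟩ ∈ order (-1) 3) ∧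
            g * a = b * g) ∧
        0 < (g * star g).re ∧ moebius (rho (-1) 3 (by norm_num) (castQ (-1) 3 g)) p.1 = q.1)) := by
  have key := two_mul_card_atkinLehnerQuotientThree_add_eq_four_mul_card_specialPointsPlus ht
  have hm0 : m ≠ 0 := by rintro rfl; rw [hm] at ht; norm_num at ht
  rw [card_specialPoints_inter_eq_card_of_sq_mul (t := t) (t₀ := 6) hm0 (by rw [hm, mul_comm]), card_specialPoints_table.2.2.1,
    card_specialPoints_inter_eq_zero (by norm_num) (not_rat_sq_one₁₆ (not_sq_of_six_mul_sq₁₆ ht.ne' hm))] at key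
  omega

/-- **`#(Pt(t)/Γ₆^{(3)})` IS ODD IFF `t ∈ ℤ² ∪ 6ℤ²`** (`t > 0`): `2N − 1` against `2N`. [cite: Ogg1983RealPoints, §2 (2)–(4)] [cite: BayerTravesa2007, §2 and §7 Table 9] [cite: KudlaRapoportYang2006, §3.4 Remark 3.4.7] -/
theorem odd_card_atkinLehnerQuotientThree_iff {t : ℤ} (ht : 0 < t) :
    Odd (Nat.card (Quot (fun p q : {τ : ℂ // 0 < τ.im ∧ ∃ x : ℍ[ℚ,((-1 : ℤ) : ℚ),((3 : ℤ) : ℚ)],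
        x ∈ order (-1) 3 ∧ x.re = 0 ∧ (x * star x).re = t ∧ moebius (rho (-1) 3 (by norm_num) (castQ (-1) 3 x)) τ = τ} ↦
      ∃ g : ℍ[ℚ,((-1 : ℤ) : ℚ),((3 : ℤ) : ℚ)], g ≠ 0 ∧
        (∀ a : ℍ[ℚ,((-1 : ℤ) : ℚ),((3 : ℤ) : ℚ)], (a ∈ order (-1) 3 ∨ a - ⟨1/2, 1/2, 1/2, -1/2⟩ ∈ order (-1) 3) →
          ∃ b : ℍ[ℚ,((-1 : ℤ) : ℚ),((3 : ℤ) : ℚ)], (b ∈ order (-1) 3 ∨ b - ⟨1/2, 1/2, 1/2, -1/2⟩ ∈ order (-1) 3) ∧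
            g * a = b * g) ∧
        0 < (g * star g).re ∧ (∃ s : ℚ, (g * star g).re = s ^ 2 ∨ (g * star g).re = 3 * s ^ 2) ∧
        moebius (rho (-1) 3 (by norm_num) (castQ (-1) 3 g)) p.1 = q.1))) ↔
    (∃ m : ℤ, t = m ^ 2) ∨ (∃ m : ℤ, t = 6 * m ^ 2) := by
  rw [Nat.odd_iff]
  constructor
  · intro h
    by_contra hne
    have h₁ : ¬ ∃ m : ℤ, t = m ^ 2 := fun h' ↦ hne (Or.inl h')
    have h₂ : ¬ ∃ m : ℤ, t = 6 * m ^ 2 := fun h' ↦ hne (Or.inr h')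
    have key := card_atkinLehnerQuotientThree_eq_two_mul_card_specialPointsPlus_of_not_of_not ht h₁ h₂
    omega
  · rintro (⟨m, hm⟩ | ⟨m, hm⟩)
    · have key := card_atkinLehnerQuotientThree_add_one_eq_two_mul_card_specialPointsPlus_of_sq ht hm
      omega
    · have key := card_atkinLehnerQuotientThree_add_one_eq_two_mul_card_specialPointsPlus_of_six_mul_sq ht hm
      omega

/-- **`2·#(Pt(t)/Γ₆^{(6)}) + #((Pt(t) ∩ Pt(1))/Γ₆) + #((Pt(t) ∩ Pt(3))/Γ₆) = 4·#(Pt(t)/Γ₆⁺)`, EVERY `t > 0`** —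
Burnside for `W` minus Burnside for `⟨ω_6⟩`: the double cover `X₆^{(6)} → X₆⁺` restricted to `Z(t)` is ramified exactly
at the images of the fixed points of the two OTHER involutions. [cite: Ogg1983RealPoints, §2 (2)–(4)] [cite: BayerTravesa2007, §2] [cite: KudlaRapoportYang2006, §3.4 Remark 3.4.7] -/
theorem two_mul_card_atkinLehnerQuotientSix_add_eq_four_mul_card_specialPointsPlus {t : ℤ} (ht : 0 < t) :
    2 * Nat.card (Quot (fun p q : {τ : ℂ // 0 < τ.im ∧ ∃ x : ℍ[ℚ,((-1 : ℤ) : ℚ),((3 : ℤ) : ℚ)],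
        x ∈ order (-1) 3 ∧ x.re = 0 ∧ (x * star x).re = t ∧ moebius (rho (-1) 3 (by norm_num) (castQ (-1) 3 x)) τ = τ} ↦
      ∃ g : ℍ[ℚ,((-1 : ℤ) : ℚ),((3 : ℤ) : ℚ)], g ≠ 0 ∧
        (∀ a : ℍ[ℚ,((-1 : ℤ) : ℚ),((3 : ℤ) : ℚ)], (a ∈ order (-1) 3 ∨ a - ⟨1/2, 1/2, 1/2, -1/2⟩ ∈ order (-1) 3) →
          ∃ b : ℍ[ℚ,((-1 : ℤ) : ℚ),((3 : ℤ) : ℚ)], (b ∈ order (-1) 3 ∨ b - ⟨1/2, 1/2, 1/2, -1/2⟩ ∈ order (-1) 3) ∧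
            g * a = b * g) ∧
        0 < (g * star g).re ∧ (∃ s : ℚ, (g * star g).re = s ^ 2 ∨ (g * star g).re = 6 * s ^ 2) ∧
        moebius (rho (-1) 3 (by norm_num) (castQ (-1) 3 g)) p.1 = q.1)) +
    Nat.card (Quot (fun p q : {τ : ℂ // 0 < τ.im ∧ (∃ x : ℍ[ℚ,((-1 : ℤ) : ℚ),((3 : ℤ) : ℚ)],
        x ∈ order (-1) 3 ∧ x.re = 0 ∧ (x * star x).re = t ∧ moebius (rho (-1) 3 (by norm_num) (castQ (-1) 3 x)) τ = τ) ∧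
        (∃ y : ℍ[ℚ,((-1 : ℤ) : ℚ),((3 : ℤ) : ℚ)], y ∈ order (-1) 3 ∧ y.re = 0 ∧ (y * star y).re = ((1 : ℤ) : ℚ) ∧
          moebius (rho (-1) 3 (by norm_num) (castQ (-1) 3 y)) τ = τ)} ↦
      ∃ v : ℍ[ℚ,((-1 : ℤ) : ℚ),((3 : ℤ) : ℚ)], (v ∈ order (-1) 3 ∨ v - ⟨1/2, 1/2, 1/2, -1/2⟩ ∈ order (-1) 3) ∧
        v * star v = 1 ∧ moebius (rho (-1) 3 (by norm_num) (castQ (-1) 3 v)) p.1 = q.1)) +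
    Nat.card (Quot (fun p q : {τ : ℂ // 0 < τ.im ∧ (∃ x : ℍ[ℚ,((-1 : ℤ) : ℚ),((3 : ℤ) : ℚ)],
        x ∈ order (-1) 3 ∧ x.re = 0 ∧ (x * star x).re = t ∧ moebius (rho (-1) 3 (by norm_num) (castQ (-1) 3 x)) τ = τ) ∧
        (∃ y : ℍ[ℚ,((-1 : ℤ) : ℚ),((3 : ℤ) : ℚ)], y ∈ order (-1) 3 ∧ y.re = 0 ∧ (y * star y).re = ((3 : ℤ) : ℚ) ∧
          moebius (rho (-1) 3 (by norm_num) (castQ (-1) 3 y)) τ = τ)} ↦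
      ∃ v : ℍ[ℚ,((-1 : ℤ) : ℚ),((3 : ℤ) : ℚ)], (v ∈ order (-1) 3 ∨ v - ⟨1/2, 1/2, 1/2, -1/2⟩ ∈ order (-1) 3) ∧
        v * star v = 1 ∧ moebius (rho (-1) 3 (by norm_num) (castQ (-1) 3 v)) p.1 = q.1)) =
    4 * Nat.card (Quot (fun p q : {τ : ℂ // 0 < τ.im ∧ ∃ x : ℍ[ℚ,((-1 : ℤ) : ℚ),((3 : ℤ) : ℚ)],
        x ∈ order (-1) 3 ∧ x.re = 0 ∧ (x * star x).re = t ∧ moebius (rho (-1) 3 (by norm_num) (castQ (-1) 3 x)) τ = τ} ↦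
      ∃ g : ℍ[ℚ,((-1 : ℤ) : ℚ),((3 : ℤ) : ℚ)], g ≠ 0 ∧
        (∀ a : ℍ[ℚ,((-1 : ℤ) : ℚ),((3 : ℤ) : ℚ)], (a ∈ order (-1) 3 ∨ a - ⟨1/2, 1/2, 1/2, -1/2⟩ ∈ order (-1) 3) →
          ∃ b : ℍ[ℚ,((-1 : ℤ) : ℚ),((3 : ℤ) : ℚ)], (b ∈ order (-1) 3 ∨ b - ⟨1/2, 1/2, 1/2, -1/2⟩ ∈ order (-1) 3) ∧
            g * a = b * g) ∧
        0 < (g * star g).re ∧ moebius (rho (-1) 3 (by norm_num) (castQ (-1) 3 g)) p.1 = q.1)) := by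
  have hB := card_specialPoints_add_card_inter_eq_four_mul_card_specialPointsPlus ht
  have hD := card_specialPoints_add_card_inter_eq_two_mul_card_atkinLehnerQuotientSix ht
  omega

/-- **`#(Pt(t)/Γ₆^{(6)}) = 2·#(Pt(t)/Γ₆⁺)` for `t ∉ ℤ² ∪ 3ℤ²`** (`t > 0`): `Z(t)` on `X₆^{(6)}` is an
unramified double cover of `Z(t)` on `X₆⁺`. [cite: Ogg1983RealPoints, §2 (2)–(4)] [cite: BayerTravesa2007, §2] [cite: KudlaRapoportYang2006, §3.4 Remark 3.4.7 and (3.4.6)] -/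
theorem card_atkinLehnerQuotientSix_eq_two_mul_card_specialPointsPlus_of_not_of_not {t : ℤ} (ht : 0 < t)
    (h₁ : ¬ ∃ m : ℤ, t = m ^ 2) (h₂ : ¬ ∃ m : ℤ, t = 3 * m ^ 2) :
    Nat.card (Quot (fun p q : {τ : ℂ // 0 < τ.im ∧ ∃ x : ℍ[ℚ,((-1 : ℤ) : ℚ),((3 : ℤ) : ℚ)],
        x ∈ order (-1) 3 ∧ x.re = 0 ∧ (x * star x).re = t ∧ moebius (rho (-1) 3 (by norm_num) (castQ (-1) 3 x)) τ = τ} ↦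
      ∃ g : ℍ[ℚ,((-1 : ℤ) : ℚ),((3 : ℤ) : ℚ)], g ≠ 0 ∧
        (∀ a : ℍ[ℚ,((-1 : ℤ) : ℚ),((3 : ℤ) : ℚ)], (a ∈ order (-1) 3 ∨ a - ⟨1/2, 1/2, 1/2, -1/2⟩ ∈ order (-1) 3) →
          ∃ b : ℍ[ℚ,((-1 : ℤ) : ℚ),((3 : ℤ) : ℚ)], (b ∈ order (-1) 3 ∨ b - ⟨1/2, 1/2, 1/2, -1/2⟩ ∈ order (-1) 3) ∧
            g * a = b * g) ∧
        0 < (g * star g).re ∧ (∃ s : ℚ, (g * star g).re = s ^ 2 ∨ (g * star g).re = 6 * s ^ 2) ∧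
        moebius (rho (-1) 3 (by norm_num) (castQ (-1) 3 g)) p.1 = q.1)) =
    2 * Nat.card (Quot (fun p q : {τ : ℂ // 0 < τ.im ∧ ∃ x : ℍ[ℚ,((-1 : ℤ) : ℚ),((3 : ℤ) : ℚ)],
        x ∈ order (-1) 3 ∧ x.re = 0 ∧ (x * star x).re = t ∧ moebius (rho (-1) 3 (by norm_num) (castQ (-1) 3 x)) τ = τ} ↦
      ∃ g : ℍ[ℚ,((-1 : ℤ) : ℚ),((3 : ℤ) : ℚ)], g ≠ 0 ∧
        (∀ a : ℍ[ℚ,((-1 : ℤ) : ℚ),((3 : ℤ) : ℚ)], (a ∈ order (-1) 3 ∨ a - ⟨1/2, 1/2, 1/2, -1/2⟩ ∈ order (-1) 3) →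
          ∃ b : ℍ[ℚ,((-1 : ℤ) : ℚ),((3 : ℤ) : ℚ)], (b ∈ order (-1) 3 ∨ b - ⟨1/2, 1/2, 1/2, -1/2⟩ ∈ order (-1) 3) ∧
            g * a = b * g) ∧
        0 < (g * star g).re ∧ moebius (rho (-1) 3 (by norm_num) (castQ (-1) 3 g)) p.1 = q.1)) := by
  have key := two_mul_card_atkinLehnerQuotientSix_add_eq_four_mul_card_specialPointsPlus ht
  rw [card_specialPoints_inter_eq_zero (by norm_num) (not_rat_sq_one₁₆ h₁),
    card_specialPoints_inter_eq_zero (by norm_num) (not_rat_sq_three₁₆ h₂)] at key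
  omega

/-- **`#(Pt(t)/Γ₆^{(6)}) + 1 = 2·#(Pt(t)/Γ₆⁺)` for `t ∈ ℤ²`** (`t > 0`): the double cover `X₆^{(6)} → X₆⁺` on `Z(t)`
is ramified at the single image of the two `Z(1)`-points. [cite: Ogg1983RealPoints, §2 p. 284 and (3)–(4)] [cite: BayerTravesa2007, §1 Thm. 1.1 and §2] [cite: KudlaRapoportYang2006, §3.4 Remark 3.4.7 and (3.4.6)] -/
theorem card_atkinLehnerQuotientSix_add_one_eq_two_mul_card_specialPointsPlus_of_sq {t : ℤ} (ht : 0 < t)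
    {m : ℤ} (hm : t = m ^ 2) :
    Nat.card (Quot (fun p q : {τ : ℂ // 0 < τ.im ∧ ∃ x : ℍ[ℚ,((-1 : ℤ) : ℚ),((3 : ℤ) : ℚ)],
        x ∈ order (-1) 3 ∧ x.re = 0 ∧ (x * star x).re = t ∧ moebius (rho (-1) 3 (by norm_num) (castQ (-1) 3 x)) τ = τ} ↦
      ∃ g : ℍ[ℚ,((-1 : ℤ) : ℚ),((3 : ℤ) : ℚ)], g ≠ 0 ∧
        (∀ a : ℍ[ℚ,((-1 : ℤ) : ℚ),((3 : ℤ) : ℚ)], (a ∈ order (-1) 3 ∨ a - ⟨1/2, 1/2, 1/2, -1/2⟩ ∈ order (-1) 3) →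
          ∃ b : ℍ[ℚ,((-1 : ℤ) : ℚ),((3 : ℤ) : ℚ)], (b ∈ order (-1) 3 ∨ b - ⟨1/2, 1/2, 1/2, -1/2⟩ ∈ order (-1) 3) ∧
            g * a = b * g) ∧
        0 < (g * star g).re ∧ (∃ s : ℚ, (g * star g).re = s ^ 2 ∨ (g * star g).re = 6 * s ^ 2) ∧
        moebius (rho (-1) 3 (by norm_num) (castQ (-1) 3 g)) p.1 = q.1)) + 1 =
    2 * Nat.card (Quot (fun p q : {τ : ℂ // 0 < τ.im ∧ ∃ x : ℍ[ℚ,((-1 : ℤ) : ℚ),((3 : ℤ) : ℚ)],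
        x ∈ order (-1) 3 ∧ x.re = 0 ∧ (x * star x).re = t ∧ moebius (rho (-1) 3 (by norm_num) (castQ (-1) 3 x)) τ = τ} ↦
      ∃ g : ℍ[ℚ,((-1 : ℤ) : ℚ),((3 : ℤ) : ℚ)], g ≠ 0 ∧
        (∀ a : ℍ[ℚ,((-1 : ℤ) : ℚ),((3 : ℤ) : ℚ)], (a ∈ order (-1) 3 ∨ a - ⟨1/2, 1/2, 1/2, -1/2⟩ ∈ order (-1) 3) →
          ∃ b : ℍ[ℚ,((-1 : ℤ) : ℚ),((3 : ℤ) : ℚ)], (b ∈ order (-1) 3 ∨ b - ⟨1/2, 1/2, 1/2, -1/2⟩ ∈ order (-1) 3) ∧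
            g * a = b * g) ∧
        0 < (g * star g).re ∧ moebius (rho (-1) 3 (by norm_num) (castQ (-1) 3 g)) p.1 = q.1)) := by
  have key := two_mul_card_atkinLehnerQuotientSix_add_eq_four_mul_card_specialPointsPlus ht
  have hm0 : m ≠ 0 := by rintro rfl; rw [hm] at ht; norm_num at ht
  rw [card_specialPoints_inter_eq_card_of_sq_mul (t := t) (t₀ := 1) hm0 (by rw [hm, mul_one]), card_specialPoints_table.1,
    card_specialPoints_inter_eq_zero (by norm_num) (not_rat_sq_three₁₆ (not_three_mul_sq_of_sq₁₆ ht.ne' hm))] at key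
  omega

/-- **`#(Pt(t)/Γ₆^{(6)}) + 1 = 2·#(Pt(t)/Γ₆⁺)` for `t ∈ 3ℤ²`** (`t > 0`): the double cover `X₆^{(6)} → X₆⁺` on `Z(t)`
is ramified at the single image of the two `Z(3)`-points. [cite: Ogg1983RealPoints, §2 p. 284 and (3)–(4)] [cite: BayerTravesa2007, §1 Thm. 1.1 and §2] [cite: KudlaRapoportYang2006, §3.4 Remark 3.4.7 and (3.4.6)] -/
theorem card_atkinLehnerQuotientSix_add_one_eq_two_mul_card_specialPointsPlus_of_three_mul_sq {t : ℤ} (ht : 0 < t)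
    {m : ℤ} (hm : t = 3 * m ^ 2) :
    Nat.card (Quot (fun p q : {τ : ℂ // 0 < τ.im ∧ ∃ x : ℍ[ℚ,((-1 : ℤ) : ℚ),((3 : ℤ) : ℚ)],
        x ∈ order (-1) 3 ∧ x.re = 0 ∧ (x * star x).re = t ∧ moebius (rho (-1) 3 (by norm_num) (castQ (-1) 3 x)) τ = τ} ↦
      ∃ g : ℍ[ℚ,((-1 : ℤ) : ℚ),((3 : ℤ) : ℚ)], g ≠ 0 ∧
        (∀ a : ℍ[ℚ,((-1 : ℤ) : ℚ),((3 : ℤ) : ℚ)], (a ∈ order (-1) 3 ∨ a - ⟨1/2, 1/2, 1/2, -1/2⟩ ∈ order (-1) 3) →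
          ∃ b : ℍ[ℚ,((-1 : ℤ) : ℚ),((3 : ℤ) : ℚ)], (b ∈ order (-1) 3 ∨ b - ⟨1/2, 1/2, 1/2, -1/2⟩ ∈ order (-1) 3) ∧
            g * a = b * g) ∧
        0 < (g * star g).re ∧ (∃ s : ℚ, (g * star g).re = s ^ 2 ∨ (g * star g).re = 6 * s ^ 2) ∧
        moebius (rho (-1) 3 (by norm_num) (castQ (-1) 3 g)) p.1 = q.1)) + 1 =
    2 * Nat.card (Quot (fun p q : {τ : ℂ // 0 < τ.im ∧ ∃ x : ℍ[ℚ,((-1 : ℤ) : ℚ),((3 : ℤ) : ℚ)],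
        x ∈ order (-1) 3 ∧ x.re = 0 ∧ (x * star x).re = t ∧ moebius (rho (-1) 3 (by norm_num) (castQ (-1) 3 x)) τ = τ} ↦
      ∃ g : ℍ[ℚ,((-1 : ℤ) : ℚ),((3 : ℤ) : ℚ)], g ≠ 0 ∧
        (∀ a : ℍ[ℚ,((-1 : ℤ) : ℚ),((3 : ℤ) : ℚ)], (a ∈ order (-1) 3 ∨ a - ⟨1/2, 1/2, 1/2, -1/2⟩ ∈ order (-1) 3) →
          ∃ b : ℍ[ℚ,((-1 : ℤ) : ℚ),((3 : ℤ) : ℚ)], (b ∈ order (-1) 3 ∨ b - ⟨1/2, 1/2, 1/2, -1/2⟩ ∈ order (-1) 3) ∧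
            g * a = b * g) ∧
        0 < (g * star g).re ∧ moebius (rho (-1) 3 (by norm_num) (castQ (-1) 3 g)) p.1 = q.1)) := by
  have key := two_mul_card_atkinLehnerQuotientSix_add_eq_four_mul_card_specialPointsPlus ht
  have hm0 : m ≠ 0 := by rintro rfl; rw [hm] at ht; norm_num at ht
  rw [card_specialPoints_inter_eq_card_of_sq_mul (t := t) (t₀ := 3) hm0 (by rw [hm, mul_comm]), card_specialPoints_table.2.1,
    card_specialPoints_inter_eq_zero (by norm_num) (not_rat_sq_one₁₆ (not_sq_of_three_mul_sq₁₆ ht.ne' hm))] at key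
  omega

/-- **`#(Pt(t)/Γ₆^{(6)})` IS ODD IFF `t ∈ ℤ² ∪ 3ℤ²`** (`t > 0`): `2N − 1` against `2N`. [cite: Ogg1983RealPoints, §2 (2)–(4)] [cite: BayerTravesa2007, §2 and §7 Table 9] [cite: KudlaRapoportYang2006, §3.4 Remark 3.4.7] -/
theorem odd_card_atkinLehnerQuotientSix_iff {t : ℤ} (ht : 0 < t) :
    Odd (Nat.card (Quot (fun p q : {τ : ℂ // 0 < τ.im ∧ ∃ x : ℍ[ℚ,((-1 : ℤ) : ℚ),((3 : ℤ) : ℚ)],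
        x ∈ order (-1) 3 ∧ x.re = 0 ∧ (x * star x).re = t ∧ moebius (rho (-1) 3 (by norm_num) (castQ (-1) 3 x)) τ = τ} ↦
      ∃ g : ℍ[ℚ,((-1 : ℤ) : ℚ),((3 : ℤ) : ℚ)], g ≠ 0 ∧
        (∀ a : ℍ[ℚ,((-1 : ℤ) : ℚ),((3 : ℤ) : ℚ)], (a ∈ order (-1) 3 ∨ a - ⟨1/2, 1/2, 1/2, -1/2⟩ ∈ order (-1) 3) →
          ∃ b : ℍ[ℚ,((-1 : ℤ) : ℚ),((3 : ℤ) : ℚ)], (b ∈ order (-1) 3 ∨ b - ⟨1/2, 1/2, 1/2, -1/2⟩ ∈ order (-1) 3) ∧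
            g * a = b * g) ∧
        0 < (g * star g).re ∧ (∃ s : ℚ, (g * star g).re = s ^ 2 ∨ (g * star g).re = 6 * s ^ 2) ∧
        moebius (rho (-1) 3 (by norm_num) (castQ (-1) 3 g)) p.1 = q.1))) ↔
    (∃ m : ℤ, t = m ^ 2) ∨ (∃ m : ℤ, t = 3 * m ^ 2) := by
  rw [Nat.odd_iff]
  constructor
  · intro h
    by_contra hne
    have h₁ : ¬ ∃ m : ℤ, t = m ^ 2 := fun h' ↦ hne (Or.inl h')
    have h₂ : ¬ ∃ m : ℤ, t = 3 * m ^ 2 := fun h' ↦ hne (Or.inr h')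
    have key := card_atkinLehnerQuotientSix_eq_two_mul_card_specialPointsPlus_of_not_of_not ht h₁ h₂
    omega
  · rintro (⟨m, hm⟩ | ⟨m, hm⟩)
    · have key := card_atkinLehnerQuotientSix_add_one_eq_two_mul_card_specialPointsPlus_of_sq ht hm
      omega
    · have key := card_atkinLehnerQuotientSix_add_one_eq_two_mul_card_specialPointsPlus_of_three_mul_sq ht hm
      omega

end AtkinLehner

end Literature.Geometry.Kaehler.ComplexTorus.QuaternionType
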